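import Mathlib
import HarnessLib
import Literature.Analysis.FluidPDE.LagrangianLatticeCarrier
import Summits.AnomalousDissipation.AnomalousDissipation.Theses.SolenoidalFractalHomogenisation
import Literature.Analysis.FluidPDE.PassiveVectorTensor
import Summits.AnomalousDissipation.AnomalousDissipation.Theorems.SolenoidalFractalHomogenisationLagrangianStepDefs
import Summits.AnomalousDissipation.AnomalousDissipation.Theorems.SolenoidalFractalHomogenisationLagrangianRenormalisationStepCascadeTelescoping
import Summits.AnomalousDissipation.AnomalousDissipation.Theorems.SolenoidalFractalHomogenisationLagrangianStepExistsL
import Summits.AnomalousDissipation.AnomalousDissipation.Theorems.SolenoidalFractalHomogenisationLagrangianStepBaseT  -- v14: stub_baseT DISCHARGED by p612457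
import Summits.AnomalousDissipation.AnomalousDissipation.Theorems.SolenoidalFractalHomogenisationLagrangianStepOneLevelDefs  -- v15: the «v10 definitions» block, landed p613864
import Summits.AnomalousDissipation.AnomalousDissipation.Theorems.SolenoidalFractalHomogenisationLagrangianStepOneLevelGlue  -- v15: the proved glue (`chain_of_pieces`, windows, named chain), landed p614475
import Literature.Analysis.FluidPDE.PassiveVectorTensorLionsExistence  -- v19: Lions existence for window tensors (F-p4g7-2)
import Summits.AnomalousDissipation.AnomalousDissipation.Theorems.SolenoidalFractalHomogenisationRealisedQuasiStaticCellLawSingleMode  -- v20: single-mode datum facts (F-p4g7-3)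
import Summits.AnomalousDissipation.AnomalousDissipation.Theorems.SolenoidalFractalHomogenisationRealisedQuasiStaticCellLawCellUnique  -- v21: cell carrier in L∞ (F-p4g7-4)
import Literature.Analysis.FluidPDE.PassiveVectorTensorEnergyDecay  -- v21: tensor energy inequality (F-p4g7-4)
import Summits.AnomalousDissipation.AnomalousDissipation.Theorems.SolenoidalFractalHomogenisationLagrangianRenormalisationStepExistsL
import Summits.AnomalousDissipation.AnomalousDissipation.Theorems.SolenoidalFractalHomogenisationLagrangianStepOneLevelGlueLower  -- v21: landed p629119 (v18/v19 inline blocks)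
import Summits.AnomalousDissipation.AnomalousDissipation.Theorems.SolenoidalFractalHomogenisationLagrangianStepCellClauseCuts  -- v21: landed p629134 (defs SlowVectorClauseNoEx / CellEnergyClausesNoE + adapters)
import Summits.AnomalousDissipation.AnomalousDissipation.Theorems.SolenoidalFractalHomogenisationLagrangianRenormalisationStepTailL  -- K1L_D v1′: stub_tailL DISCHARGED by p635434 (ad-k3l-bookkeeping-p1 g3)
import Summits.AnomalousDissipation.AnomalousDissipation.Theorems.SolenoidalFractalHomogenisationLagrangianStepGainPackageW0  -- K1L_D v2: stub_gainPackageW0 DISCHARGED by p639096 (ad-k3l-bookkeeping-p1 g3)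
import Summits.AnomalousDissipation.AnomalousDissipation.Theorems.SolenoidalFractalHomogenisationLagrangianStepCellClauseCutsW  -- v2: F0, defs CellEnergyClausesWNoE / CellEnergyClausesW + adapters (p4 g10 / taker g3)
import Summits.AnomalousDissipation.AnomalousDissipation.Theorems.SolenoidalFractalHomogenisationLagrangianStepCellClauseCutsFamily  -- v2: F2, defs SlowVectorClauseF / SlowVectorClauseNoExF + adapters
import Summits.AnomalousDissipation.AnomalousDissipation.Theorems.SolenoidalFractalHomogenisationLagrangianStepOneLevelGlueLowerFamilyGlue  -- v2: F3b `chainLower_of_pieces_ISW` (imports F1 OneLevelDefsFamily/Sectorial, F3a GlueLowerFamily)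
import Summits.AnomalousDissipation.AnomalousDissipation.Theorems.SolenoidalFractalHomogenisationLagrangianStepCellEnergyT  -- v2′: stub_cellEnergyT DISCHARGED by p640158 (lead-k1l-onelevel-p1 g0, `:= cellEnergyT_W`)
import Summits.AnomalousDissipation.AnomalousDissipation.Theorems.SolenoidalFractalHomogenisationLagrangianStepOneLevelSplitGlueL  -- v3 (cut-2): `oneLevelL_IW_of_piecesL : S0′ → S23″ → IW` (p4 g11 text, landed by taker g4) — brings DefsL (`gridL`, `seqL`), ApiL, Defs p647662 (V2 datumLp …), Api p648179, Literature PassiveVectorTensorPropagator p647395 (`Torus.IsPropagator`), WindowLedgerAbs p645039, LedgerTrim p649567, DatumTrim p651235, ClassTruncate p650759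
import Summits.AnomalousDissipation.AnomalousDissipation.Theorems.SolenoidalFractalHomogenisationLagrangianStepWindowPropagatorL  -- v3: S0′ `stub_windowPropagatorL` DISCHARGED on registration by p648539 (taker g4, `:= windowPropagatorL` over `Torus.exists_isPropagator`)
import Summits.AnomalousDissipation.AnomalousDissipation.Theorems.SolenoidalFractalHomogenisationLagrangianStepOneLevelSplitDefsH  -- v4: `HighLabelDecayW` (DefsH p659807, text p4 g12) — hypothesis (H) of S23‴ / IW_H, conclusion of W7
import Summits.AnomalousDissipation.AnomalousDissipation.Theorems.SolenoidalFractalHomogenisationLagrangianStepOneLevelSplitGlueH  -- v4′: the two v4 glues `chainLower_of_oneLevel_at` / `oneLevelL_IWH_of_piecesH` LANDED (ad-k3l-bookkeeping-p1 g5, p661506 — byte-for-byte HOME/ad-ideate-p1/r25/v4/SolenoidalFractalHomogenisationLagrangianStepOneLevelSplitGlueH.lean fa6eb1ec3c9207ee) — inline block removed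
import Summits.AnomalousDissipation.AnomalousDissipation.Theorems.SolenoidalFractalHomogenisationLagrangianStepOneLevelSplitDefsW7  -- v5: `ClassDecayW` + adm predicates + splice (DefsW7, text p5 g9 re-cut ll.35–108; tenure D25-4) — the W7 pieces are stated over it
import Summits.AnomalousDissipation.AnomalousDissipation.Theorems.SolenoidalFractalHomogenisationLagrangianStepWindowDefectHGlue  -- v6: S23‴ `stub_windowDefectH` DISCHARGED from the operator-level stub `stub_windowFactsH` by `windowDefectH_of_windowFacts` (lead g3, p665050)
import Summits.AnomalousDissipation.AnomalousDissipation.Theorems.SolenoidalFractalHomogenisationLagrangianStepCompactRange  -- v11: W7 pieces 2+3 `stub_compactRange`/`stub_largeR` PROVED BY NAME (p1 g11, p677887)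
import Summits.AnomalousDissipation.AnomalousDissipation.Theorems.SolenoidalFractalHomogenisationLagrangianStepWindowFactsHAssemblyV2  -- v10: `windowFactsH_of_inputs₂` (p677563, §4c v30)
import Summits.AnomalousDissipation.AnomalousDissipation.Theorems.SolenoidalFractalHomogenisationLagrangianStepWindowFactsHAssemblyV3  -- v12: `windowFactsH_of_inputs₃` (p679770, prover ad-k1loc-p3 g7; §4c v31 text, F-k3l-6 / D25-13)
import Summits.AnomalousDissipation.AnomalousDissipation.Theorems.SolenoidalFractalHomogenisationLagrangianStepEffectiveFrameEnergyLDissipation  -- v13: clause (i) of `stub_effectiveFrameEnergyL` DISCHARGED BY NAME by `effectiveFrameEnergyL_dissipation` (p681732, prover ad-k3l-bookkeeping-p1 g6); clause (ii) = new registered stub `stub_effectiveFrameEnergyL_bandKill`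
import Summits.AnomalousDissipation.AnomalousDissipation.Theorems.SolenoidalFractalHomogenisationLagrangianStepWCrossingWindow  -- v14: W-crossing glue §1–§5 LANDED (p682249 `…WCrossing` §1–§3 + p683011 `…WCrossingWindow` §4–§5 + `cellLawV0_IS_of_W_D1`, prover ad-k1loc-p3 g7, TAKES-p3 #6); `stub_cellLawV0_IS` RE-CUT into `stub_W_evenSlackB` + `stub_D1_exactFamily`
import Summits.AnomalousDissipation.AnomalousDissipation.Theorems.SolenoidalFractalHomogenisationLagrangianStepD1Split  -- v16: D1 split glue `WCrossing.D1ExactFamilyB_of_split` (p686447, p3 g7 TAKES #7)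
import Summits.AnomalousDissipation.AnomalousDissipation.Theorems.SolenoidalFractalHomogenisationLagrangianStepD1TailCert  -- v18: TAIL-CERT IN THE TREE `D1TailCert.relSmall_tail_of_table` (+ tables `gTab`/`gTabC`, `frob_gTab_le`/`frob_gTabC_le` ≤ (1/23)², `sq_le_of_slotPair`; port p3 g8 #12 p691946/p692032 of p5 g14's sorry-free spine e6aea1eb341d, kit j323438)
import Summits.AnomalousDissipation.AnomalousDissipation.Theorems.SolenoidalFractalHomogenisationLagrangianStepZ7Glue  -- v19: THE §9z GLUE v2 IS A TREE THEOREM `Z7Glue.cellInputs_BIL_of` (lead-k1l-onelevel-p1 g5, p696796; chain p692853 ModEC · p693550 · p694305 Bookkeeping · p694610 Compose · p694968 Defs · p695586 Template · p695645 Eulerian; text of record D26-15, VETTED 04:14Z)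
import Summits.AnomalousDissipation.AnomalousDissipation.Theorems.SolenoidalFractalHomogenisationLagrangianStepCellInputsOfBilinear  -- v19: `cellInputs_of_bilinear : §9z → §9d → §9` (lead g4, p680253)
import Summits.AnomalousDissipation.AnomalousDissipation.Theorems.SolenoidalFractalHomogenisationLagrangianStepCellInputsTransfer  -- v20: §9d IS A TREE THEOREM over §9z + W3-E: `cellInputs_transfer_of_bilinear_bandKill` (prover ad-k1loc-p3 g8 #17, p699453; plan = lead memo L14, D26-16; certifier PASS p5 g14)
import Summits.AnomalousDissipation.AnomalousDissipation.Theorems.SolenoidalFractalHomogenisationLagrangianStepD1SlotPairData  -- v21: lane A BY NAME `D1Tail.stub_D1_slotPairData` (prover ad-sawtooth-k1loc-p1 g13, p701440; chain p694590 … p701227)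
import Summits.AnomalousDissipation.AnomalousDissipation.Theorems.SolenoidalFractalHomogenisationLagrangianStepD1SplitR  -- v22: D27-1 R-glue `WCrossing.D1ExactFamilyR`, `D1ExactFamilyRB_of_split`, `cellLawV0_IS_of_W_D1R` (G27-1, prover ad-sawtooth-k1loc-p1 g14, p702370)
import Summits.AnomalousDissipation.AnomalousDissipation.Theorems.SolenoidalFractalHomogenisationLagrangianStepCellClauseModWDefs  -- v23: `CellClauseMod.SlowVectorClauseModECW` (Φ-image binders; F-p1g14-2), p704130 (prover ad-sawtooth-k1loc-p1 g14)
import Summits.AnomalousDissipation.AnomalousDissipation.Theorems.SolenoidalFractalHomogenisationLagrangianStepZ7GlueDefsR  -- v23: `Z7Glue.cellInputs_alphaBeta_textR` (REGISTERED, R-a guarded (N1′)/(N1*′); F-p3g9-2) / `…_textP` (consumed) + bridges, p704133 (p1 g14; byte-exact lines p3 g9 57eed6770ee3253e / ec0126feeef72fec)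
import Summits.AnomalousDissipation.AnomalousDissipation.Theorems.SolenoidalFractalHomogenisationLagrangianStepZ7GlueR  -- v23: §9z GLUE v3 core `Z7Glue.cellInputs_BIL_ofP : <stub_Vmod_of_VR text> → cellInputs_alphaBeta_textP → §9z` (p1 g14; D27-4′ (ii))
import Summits.AnomalousDissipation.AnomalousDissipation.Theorems.SolenoidalFractalHomogenisationLagrangianStepZ7GlueE  -- v24: exponent-parametric §9z core `Z7Glue.cellInputs_BIL_ofE (e) (he) : <VR text at exponent e σ> → cellInputs_alphaBeta_textP → §9z` (prover ad-sawtooth-k1loc-p1 g14, p706219); v24 instance e σ = min (σ/2) (1/2) (RULING D27-6, F-p5g14-1)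
import Summits.AnomalousDissipation.AnomalousDissipation.Theorems.SolenoidalFractalHomogenisationLagrangianStepZ7AlphaBetaR  -- v25: input of the BY-NAME discharge of `stub_Z7_alphaBetaR`
import Summits.AnomalousDissipation.AnomalousDissipation.Theorems.SolenoidalFractalHomogenisationLagrangianStepFrameCurvature  -- v25: input of the BY-NAME discharge of `stub_Z7_alphaBetaR`
import Summits.AnomalousDissipation.AnomalousDissipation.Theorems.SolenoidalFractalHomogenisationLagrangianStepZ7GlueProj  -- v23: bridge `Z7Glue.alphaBeta_textP_of_textR : textR → textP` (prover ad-k1loc-p3 g9; `LagrangianStep.nsq_starProjection_le`; D27-4′ (iii))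
import Summits.AnomalousDissipation.AnomalousDissipation.Theorems.SolenoidalFractalHomogenisationLagrangianStepEffectiveFrameEnergyLBandKill  -- v23: (J) `stub_effectiveFrameEnergyL_bandKill` DISCHARGED BY NAME by `LagrangianStep.stub_effectiveFrameEnergyL_bandKill` (prover ad-k3l-bookkeeping-p1 g8, p704419; chain (H) analytic tower p700667 / (I) cube tail p702058 / (J) SmallL p702093 · Ladder p702547 · LargeL p703792; RULING D27-5)
import Summits.AnomalousDissipation.AnomalousDissipation.Theorems.SolenoidalFractalHomogenisationLagrangianStepD1ResidueCert  -- v17: CERT-(i) v0 IN THE TREE `D1ResidueCert.relSmall_pairQS` (ρP = 115/10⁶) + `D1Residue_of_tail_unit` (p689086/p689481/p689543, port p3 g8 of p5 g13's sorry-free spine; glue p688776)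
import Summits.AnomalousDissipation.AnomalousDissipation.Theorems.SolenoidalFractalHomogenisationLagrangianStepD1Family  -- v16: A0 named exact family `WCrossing.ΨB₁ a ν := a • Sideband.psiStar cubatureWord MB MB_pos ν` (â = 1), `WCrossing.νB₁ := 1/40` (p687442, p1 g12)
import Summits.AnomalousDissipation.AnomalousDissipation.Theorems.SolenoidalFractalHomogenisationLagrangianStepWEvenCert  -- v15: `stub_W_evenSlackB` DISCHARGED BY NAME by `WEvenCert.stub_W_evenSlackB` (p685575 ACCEPTED 2026-08-29T01:19:48Z, E1-LAND p1 g12; certificate p5 g12 a0a85728cdf9)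
import Summits.AnomalousDissipation.AnomalousDissipation.Theorems.SolenoidalFractalHomogenisationLagrangianStepWindowFactsHAssembly  -- v9 cand.: `stub_windowFactsH` DISCHARGED by `windowFactsH_of_inputs` (lead g3, p672353) from stub_effectiveFrameEnergyL + stub_cellInputs
import Summits.AnomalousDissipation.AnomalousDissipation.Theorems.SolenoidalFractalHomogenisationLagrangianStepClassReduction  -- v8: W7 piece 1 `stub_classReduction` DISCHARGED by `classReduction_of_pos` (w1 g3, p668138)

/-!
# K1L_D skeleton «onelevel-design» — registry v25 OF RECORD (planner ad-ideate-p1 g27, 2026-08-29T08:06Z; RULINGS D27-7, D27-8″): = v24 with `stub_Z7_alphaBetaR` DISCHARGED BY NAME := `Z7Glue.Z7_alphaBetaR_of_hcurv FrameForm.abs_partialDeriv_frameG_le`.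
# OPEN registered stubs after v25 = sorries = 2: stub_D1_V0R, stub_Vmod_of_VR (CAVEAT D27-9: the v24 text lacks §9z's W7 high-label binder — re-cut `stub_Vmod_of_VRH` rides v26 on ACCEPT of `…Z7GlueEH`; nobody attempts the v24 text).
#
# K1L_D skeleton «onelevel-design» — registry v24 OF RECORD (planner ad-ideate-p1 g27, 2026-08-29T07:40Z; RULING D27-6): = v23 with ONE TOKEN in the
#     registered stub `stub_Vmod_of_VR`: conclusion exponent `min σ (1/2)` ↦ `min (σ/2) (1/2)` (certifier p5 g14 finding F-p5g14-1 + FINAL STAMP 07:29Z: the (ss) block of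
#     the (ℓ2) flat stage derives `min (σ/2) (1/2)` from (V)(σ); nothing downstream moves — §9z needs only some σz > 0), and the two compositions
#     `stub_cellInputs_transfer` / `stub_cellInputs` re-derived through the EXPONENT-PARAMETRIC core `Z7Glue.cellInputs_BIL_ofE (fun σ => min (σ/2) (1/2)) _`
#     (prover ad-sawtooth-k1loc-p1 g14, p706219) instead of `Z7Glue.cellInputs_BIL_ofP`; everything else byte-identical to v23 (sha256 7fcbf211…).
# OPEN registered stubs after v24 = sorries = 3: stub_D1_V0R, stub_Vmod_of_VR (v24 text), stub_Z7_alphaBetaR.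
#
# K1L_D skeleton «onelevel-design» — registry v23 OF RECORD (planner ad-ideate-p1 g27, 2026-08-29T07:2xZ; RULINGS D27-4/D27-4′ + D27-5): = v22 with
# (a) the two §9z input stubs RE-CUT (both v19–v22 texts were OVER-STRONG as typed — erratum D27-4 (5); nothing landed was affected, no by-name proof had been attempted):
#     `stub_Vmod_of_V` ↦ `stub_Vmod_of_VR` (hypothesis (H1R) of the landed glue v3 core `Z7Glue.cellInputs_BIL_ofP`, p704903: §9z guards + `ν₀ ≤ 1`, clause
#     `CellClauseMod.SlowVectorClauseModECW` with Φ-image binders p704130, capped exponent `min σ (1/2)`; findings F-p1g14-1, -2, -4, certifier P1a/P1b + 3-probe PASS) and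
#     `stub_Z7_alphaBeta` ↦ `stub_Z7_alphaBetaR : Z7Glue.cellInputs_alphaBeta_textR` (p704133: (N1)/(N1*) now guarded by `Torus.IsWeaklyDivFree`; finding F-p3g9-2, byte-exact
#     lines 57eed6770ee3253e, 3-probe PASS); downstream re-derived BY NAME: `stub_cellInputs_transfer` / `stub_cellInputs` := … `(Z7Glue.cellInputs_BIL_ofP stub_Vmod_of_VR
#     (Z7Glue.alphaBeta_textP_of_textR stub_Z7_alphaBetaR))` … (bridge p704475, prover ad-k1loc-p3 g9; texts of §9d / §9 and everything above byte-identical);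
# (b) (J) `stub_effectiveFrameEnergyL_bandKill` DISCHARGED BY NAME := `LagrangianStep.stub_effectiveFrameEnergyL_bandKill` (prover ad-k3l-bookkeeping-p1 g8, p704419; the two
#     inline comments of the registered signature removed, text otherwise verbatim).
# OPEN registered stubs after v23 = sorries = 3: stub_D1_V0R (w1 g7: T7c + T8 left), stub_Vmod_of_VR (prover ad-sawtooth-k1loc-p1 g14 lane (ℓ2)/(ℓ3); certifier p5),
# stub_Z7_alphaBetaR (α-part lead g5 (R1)(R2) + p3 g9 (R3)-closed p704979 + k3l g8 K8-5 hcurv; (N1′) p3 g9 N1Assembly + ad-lit R4′; (N2) ad-lit g29 S6 p704753 + p3 `smoothCarrier_partialSum`).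
# NOT a proof of K1L_D or AD; rung F-D1.A0.
# (v22 header, history) K1L_D skeleton «onelevel-design» — registry v22 OF RECORD (planner ad-ideate-p1 g27, 2026-08-29T06:28Z; RULING D27-1, explicit ACKs w1 g7 06:24Z · p5 g14 05:59Z · glue p1 g14 p702370): = v21 with the open D1-(ii) stub RE-CUT
# `stub_D1_V0` ↦ `stub_D1_V0R` := «registered clause-(i) text (= `stub_D1_residue`, a theorem since v21) → registered V0 text + ONE binder `β * ΛV ≤ lo / 20`» (typed
# dependency for the T6 coercivity input F-w1g7-1; window-honest by `WCrossing.window_in_sector`; consumer instance inside the guard by `WCrossing.consumer_guard`; V0(∀β) ⇒ new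
# conclusion, so all w1 work transfers); downstream re-derived BY NAME through the landed R-glue p702370 (G27-1, prover ad-sawtooth-k1loc-p1 g14): `D1_V0_window := stub_D1_V0R
# stub_D1_residue`, `stub_D1_exactFamilyR := WCrossing.D1ExactFamilyRB_of_split νB₁_pos stub_D1_residue D1_V0_window`, `stub_cellLawV0_IS := WCrossing.cellLawV0_IS_of_W_D1R
# stub_W_evenSlackB stub_D1_exactFamilyR` (its registered v2…v13 text UNCHANGED, as is everything above it).  OPEN registered stubs after v22 = sorries = 4: stub_D1_V0R (w1 g7),
# stub_effectiveFrameEnergyL_bandKill (k3l g8), stub_Vmod_of_V (p1 g14 memo-first / p5 certificate), stub_Z7_alphaBeta (lead g5 L16 clamped; (C4) p3 g9; (N2) ad-lit g29).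
# NOT a proof of K1L_D or AD; rung F-D1.A0.
# (v21 header, history) K1L_D skeleton «onelevel-design» — registry v21 OF RECORD (planner ad-ideate-p1 g27, 2026-08-29T06:14Z): = v20 with the registered stub `stub_D1_slotPairData` (lane A, v18 text)
# now a THEOREM in-skeleton `:= D1Tail.stub_D1_slotPairData` (LANDED p701440, prover ad-sawtooth-k1loc-p1 g13; 18-file chain MaskDefs … D1TailBoundPair, all ACCEPTED) — hence
# `stub_D1_residueTail` and `stub_D1_residue` (clause (i), ρB = 3/25000) are UNCONDITIONAL THEOREMS of the tree + skeleton.  OPEN registered stubs after v21 = sorries = 4: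
# stub_D1_V0 (w1 g7; D27-1: to be re-cut to `stub_D1_V0R` = «clause (i) ⇒ (ii) on the sector-honest windows β·ΛV ≤ lo/20» when the R-glue G27-1 lands), stub_effectiveFrameEnergyL_bandKill
# (k3l g8), stub_Vmod_of_V (p5 design / w1 W7-4), stub_Z7_alphaBeta (lead g5 (T1) clamped line L16 + (N1)(N1*) + (N2) ad-lit g29).  NOT a proof of K1L_D or AD; rung F-D1.A0.
# (v20 header, history) K1L_D skeleton «onelevel-design» — registry v20 OF RECORD (planner ad-ideate-p1 g26, 2026-08-29; D26-16): = v19 with `stub_cellInputs_transfer` (§9d, h9d verbatim) now a THEOREM in-skeleton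
# := `cellInputs_transfer_of_bilinear_bandKill (Z7Glue.cellInputs_BIL_of stub_Vmod_of_V stub_Z7_alphaBeta) stub_effectiveFrameEnergyL` (landed p699453, p3 g8 #17) — §9d has no independent
# cell physics (operator algebra over the §9z strong form + W3-E (i)(ii)).  OPEN registered stubs after v20 = sorries = 5: stub_D1_slotPairData (p1 g13: by-name proof p699540 submitted,
# farm-bounced on olean lag, resubmitting), stub_D1_V0 (w1 g7), stub_effectiveFrameEnergyL_bandKill (k3l g8; carries §4c (ii), (Hi) AND §9d), stub_Vmod_of_V (p5 design / w1 W7-4), stub_Z7_alphaBeta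
# (lead g5: (T1) = (C0)–(C6) per memo L15 + K8-5 hcurv; (N1)(N1*); (N2) = seat ad-lit g29, D26-17′).  NOT a proof of K1L_D or AD; rung F-D1.A0.
# (v19 header, history) K1L_D skeleton «onelevel-design» — registry v19 OF RECORD (planner ad-ideate-p1 g26, 2026-08-29; plan announced 04:14:36Z, lead g5 request 04:48Z): = v18 with `stub_cellInputs` RE-CUT at
# the LANDED §9z glue v2 `Z7Glue.cellInputs_BIL_of` (p696796) composed through the landed `cellInputs_of_bilinear : §9z → §9d → §9` (p680253):
# * NEW registered stub `stub_Vmod_of_V` = hypothesis (H1) of the glue VERBATIM: (V) ⇒ (V_modEC) with own constant `Cm ≥ C` (capped transient, D26-13′/D26-14; certificate side p5 g14: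
#   sup η ≈ 22 nominal at the tent peak, docstring floor Cm ≥ 50; owners: (V_mod) certificate p5/w1 lineage + the V0 machinery of w1 g6).
# * NEW registered stub `stub_Z7_alphaBeta : Z7Glue.cellInputs_alphaBeta_text` (by name; lead g5 lane: (α₁)(α₂) frame conjugacy via L5-0 `isModulation_frameG_of` p695470 +
#   `…FrameNearIdentity`/`…FrameRate` p696381/p696685 + K8-5 `hcurv` + torus Piola + L5-3′ frame equivalence of weak solutions; (N1)(N1*) N-conversions; (N2) = `…LossQuasiMonotone` p693776 + L6 PDE half).
# * NEW registered stub `stub_cellInputs_transfer` = §9d (Recin) VERBATIM = hypothesis `h9d` of `cellInputs_of_bilinear` (UNOWNED; derivation brief owed by lead g5; W4/(H) facts).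
# * `stub_cellInputs` is now a THEOREM in-skeleton: `cellInputs_of_bilinear (Z7Glue.cellInputs_BIL_of stub_Vmod_of_V stub_Z7_alphaBeta) stub_cellInputs_transfer` (registered v9/v11 text verbatim).
# OPEN registered stubs after v19 = sorries = 6: stub_D1_slotPairData, stub_D1_V0, stub_effectiveFrameEnergyL_bandKill, stub_Vmod_of_V, stub_Z7_alphaBeta, stub_cellInputs_transfer.
# NOT a proof of K1L_D or AD; rung F-D1.A0.
# (v18 header, history) K1L_D skeleton «onelevel-design» — registry v18 OF RECORD (planner ad-ideate-p1 g26, 2026-08-29; D26-12): = v17 with `stub_D1_residueTail` RE-CUT at the LANDED,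
# SORRY-FREE tail certificate T1 — `D1TailCert.relSmall_tail_of_table` (ONE weighted Cauchy–Schwarz over the 676 ordered slot pairs `sq_le_of_slotPair` feeding the
# landed socket `D1ResidueCert.relSmall_of_Nbar`; the ν-FREE tables `gTab` / `gTabC` with `frob_gTab_le` / `frob_gTabC_le` ≤ (1/23)², true weight 1.243·10⁻⁷;
# planner ad-ideate-p5 g14 certificate e6aea1eb341d, kit j323438; Theorems port p691946 `…D1TailCertDefs` / p692032 `…D1TailCert`, prover ad-k1loc-p3 g8 #12):
# * NEW registered stub `stub_D1_slotPairData` (lane A by name; owners prover ad-sawtooth-k1loc-p1 lineage — g12 landed the structure chain p688466→p688908→p690140→p690833→p693416→p691256→p693472, successor g13 (G13-1 assembly, G13-2 hstruct, G13-3 hbound cases A–E)):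
#   at every block-window point a slot-pair presentation `F` of `bsymb (psiStar ν S − excQS S − pairQS S)` on transverse pairs and a dominating table `g` of Frobenius
#   weight ≤ (1/23)² (`gTab`/`gTabC` certified; `F` free per point — D26-12, objection window passed in silence).
# * `stub_D1_residueTail` is now a THEOREM in-skeleton: `obtain ⟨g, hg, F, hs, hb⟩ := stub_D1_slotPairData …; exact D1TailCert.relSmall_tail_of_table hg hS hτ hodd F hs hb`
#   (registered v17 text verbatim); `stub_D1_residue` (v16 text) and `stub_D1_exactFamily` (v14 text) stay theorems above it.
# OPEN registered stubs after v18 = sorries = 4: stub_D1_slotPairData, stub_D1_V0, stub_effectiveFrameEnergyL_bandKill, stub_cellInputs.  NOT a proof of K1L_D or AD; rung F-D1.A0.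
# (v17 header, history) v17 = v16 with `stub_D1_residue` re-cut at the landed pair-memory certificate CERT-(i) v0 `D1ResidueCert.relSmall_pairQS` (ρP = 115/10⁶; p5 g13,
# kit j322277/j322297; port p689086/p689481/p689543 p3 g8) via `D1ResidueCert.D1Residue_of_tail_unit`; new stub then was `stub_D1_residueTail` (a-free unit form, ρT = 1/200000).
-/

/-!
# K1L_D skeleton «onelevel-design» — registry v16 OF RECORD (planner ad-ideate-p1 g26, 2026-08-29; D26-7 VARIANT A): = v15 with `stub_D1_exactFamily` RE-CUT BY CLAUSE at the
# landed split glue `WCrossing.D1ExactFamilyB_of_split` (Theorems/…LagrangianStepD1Split.lean p686447, prover ad-k1loc-p3 g7, TAKES-p3 #7; UNCONDITIONAL — `transNonneg_ΦB` inside)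
# over the NAMED exact family of record `WCrossing.ΨB₁ a ν = a • Sideband.psiStar cubatureWord MB MB_pos ν` (â = 1: the diagonal of the period-mean feedback of the
# truncated ξ = 0 fast block IS the excQS slot term, p1 g12 A1(c), kit j322426; D26-3 definition of record `Sideband.psiStar` p682189, w1 g5) on ν ∈ (0, νB₁], `WCrossing.νB₁ = 1/40`
# (Theorems/…LagrangianStepD1Family.lean p687442, p1 g12 A0):
# * NEW registered stub `stub_D1_residue` (clause (i): ν-UNIFORM RESIDUE of ΨB₁ against ΦB a = a • excQS in `RelSmall` currency, budget ρB = 3/25000, block window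
#   NearIso(10/11, 11/10) × OddSectorial(≤ 1/20), every a > 0, ν ∈ (0, νB₁]; owners: p5 g13 CERT-(i) v0 (O_h-reduced 0-dimensional finite core, sup 1.1080e-4 ≤ 1.2e-4) for the
#   13 colinear-adjacent pair-memory terms + p1 g12 A1 (structure: meanFeedback = diag QS + 13 pairs + e^{−Tb} pieces) / A4 (tails) / A5 (glue via `RelSmall.add/sum/mono` p687315));
# * NEW registered stub `stub_D1_V0` (clause (ii): the slow-vector law (V0) WITHOUT existence for the family ΨB₁ a, amplitude c = c(a); owner the w1 lineage (g6: T4 chain,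
#   F-w1g6-1 transverse-symbol Lipschitz, k-transversal reference), V0 memo `Lines/onelevel-V0-exact-family.md`);
# * `stub_D1_exactFamily` is now a THEOREM in-skeleton: `:= WCrossing.D1ExactFamilyB_of_split WCrossing.νB₁_pos stub_D1_residue stub_D1_V0` (registered v14/v15 text verbatim).
# OPEN registered stubs after v16 = sorries = 4: stub_D1_residue, stub_D1_V0, stub_effectiveFrameEnergyL_bandKill, stub_cellInputs.  NOT a proof of K1L_D or AD; rung F-D1.A0.
-/

/-!
# K1L_D skeleton «onelevel-design» — registry v15 OF RECORD (planner ad-ideate-p1 g26, 2026-08-29 ≈01:25Z; E1-LAND `Theorems/…LagrangianStepWEvenCert.lean` p685575 ACCEPTED 01:19:48Z;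
# farm rc 0 / sorries 3): = v14 with `stub_W_evenSlackB` DISCHARGED BY NAME := `WEvenCert.stub_W_evenSlackB` (the E1 even certificate: p5 g12 spine, p1 g12 S2/N110 + port, p3 g7 N-points;
# sheet of record D26-1).  OPEN registered stubs after v15 = sorries = 3: stub_D1_exactFamily, stub_effectiveFrameEnergyL_bandKill, stub_cellInputs.  NOT a proof of AD; F-D1.A0.
-/

/-!
# K1L_D skeleton «onelevel-design» — registry v14 (REGISTERED by planner ad-ideate-p1 g26, 2026-08-29, D26-4): = v13 with `stub_cellLawV0_IS` RE-CUT at the (W)-crossing interface of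
# `Lines/onelevel_W_crossing.lean` v2 (p5 g11, f677fdc0e2c7), whose sorry-free part is LANDED as `Theorems/…LagrangianStepWCrossing.lean` (p682249, §1–§3) +
# `Theorems/…LagrangianStepWCrossingWindow.lean` (p683011, §4–§5 + glue `cellLawV0_IS_of_W_D1`; prover ad-k1loc-p3 g7, TAKES-p3 #6; one namespace `…LagrangianStep.WCrossing`):
# NEW registered stubs `stub_W_evenSlackB : ∃ a > 0, WCrossing.EvenSlackWindowB a WCrossing.ρB` (E1 even certificate: p5 spine + p1 S2/N110 + p3 N-points) and
# `stub_D1_exactFamily : ∀ a > 0, WCrossing.D1ExactFamily (WCrossing.ΦB a) WCrossing.ρB WCrossing.MB WCrossing.MB_pos` (clause (i) residue ∀a — UNSEATED ask 7; clause (ii) V0 — w1,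
# D26-3 family); `stub_cellLawV0_IS` := theorem `WCrossing.cellLawV0_IS_of_W_D1 stub_W_evenSlackB stub_D1_exactFamily` (its `ScalarLawBlock` hypothesis unused on this line).
# OPEN registered stubs after v14 = sorries = 4: stub_W_evenSlackB, stub_D1_exactFamily, stub_effectiveFrameEnergyL_bandKill, stub_cellInputs.  NOT a proof of AD; F-D1.A0.
-/

/-!
# K1L_D skeleton «onelevel-design» — registry v13 (REGISTERED by planner ad-ideate-p1 g26, 2026-08-29): = v12 with the W3-E stub `stub_effectiveFrameEnergyL` (§4c v31 text)
# RE-CUT BY CLAUSE: clause (i) (dissipation floor of `Um s s'` and its adjoint) is DISCHARGED BY NAME by the landed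
# `LagrangianStep.effectiveFrameEnergyL_dissipation` (`Theorems/…LagrangianStepEffectiveFrameEnergyLDissipation.lean`, p681732, prover ad-k3l-bookkeeping-p1 g6 —
# statement = the v31 binders verbatim + conjunct (i), `∃ θ₁ > 0`); clause (ii) ((ii-out) ∧ (ii-in), the band kill in engine-A currency, `∃ C₂ ≥ 1, θ₁ > 0, c₃ > 0`)
# becomes the NEW REGISTERED STUB `stub_effectiveFrameEnergyL_bandKill` (same v31 binders verbatim, conclusion = the (ii-out) ∧ (ii-in) conjuncts of the v12 text
# byte-for-byte; holder: successor ad-k3l-bookkeeping-p1 g7, plan = thin-band ladder with cube cut-offs, HOME/ad-k3l-bookkeeping-p1/as-proposed-g6/NOTES.md l.25).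
# `stub_effectiveFrameEnergyL` itself is now a THEOREM proved in-skeleton from the two (θ₁ := min of the two strain ceilings; both clauses are monotone in the
# ceiling hypothesis `∀ i, E.θ (i+1) ≤ θ₁`).  v12's discharge `stub_windowFactsH := windowFactsH_of_inputs₃ stub_effectiveFrameEnergyL stub_cellInputs` and the
# composition `LagrangianRenormalisationStepDesign_of` are byte-unchanged.  OPEN registered stubs after v13 = sorries = 3: `stub_cellLawV0_IS` (XL; E1 even certificate
# p5/p1/p3 + V0 clause (ii) w1 (D26-3 family) + D1 clause (i) unseated), `stub_effectiveFrameEnergyL_bandKill` (L; k3l g7), `stub_cellInputs` (XL−; lead g4 split v31 §9z/§9d).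
# NOT a proof of AD; K1L_D not closed; rung F-D1.A0.
-/

/-!
# K1L_D skeleton «onelevel-design» — registry v12 (REGISTERED by planner ad-ideate-p1 g26, 2026-08-29: = v11 with `stub_effectiveFrameEnergyL` := §4c **v31** text = v30 + F-k3l-6 binders (a) `(∀ m, E.N m ^ 2 ≤ E.N (m + 1)) →` after the all-levels strain ceiling, (b) `Torus.OddSmall S β → Torus.NearIso S lo hi →` before the Φ-shape hypotheses — tenure D25-13 — and `stub_windowFactsH` DISCHARGED in-skeleton by the landed V3 assembly `windowFactsH_of_inputs₃` (prover ad-k1loc-p3 g7, p679770); OPEN stubs 3: cellLawV0_IS, effectiveFrameEnergyL [v31], cellInputs; composition `LagrangianRenormalisationStepDesign_of` unchanged) ; v11 (= v10 with W7 pieces 2+3 `stub_compactRange` + `stub_largeR` DISCHARGED in-skeleton by the theorems of the same names landed BY NAME + SIGNATURE in `…Theorems.SolenoidalFractalHomogenisationLagrangianStepCompactRange` (prover ad-sawtooth-k1loc-p1 g11, p677887, from `W7Cell.classDecayW_cubature_all` + `classDecayW_mono`); OPEN stubs 3: cellLawV0_IS, effectiveFrameEnergyL, cellInputs; registered by planner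 ad-ideate-p1 g25) ; v10 (= v9 with ONE binder re-cut in the registered, unlanded `stub_effectiveFrameEnergyL`: the strain ceiling `E.θ (i+1) ≤ θ₁` is asked at ALL levels i, not only the window level (F-k3l-5 / D25-12; split v30 §4c verbatim), and `stub_windowFactsH` discharged by the v2 assembly `windowFactsH_of_inputs₂` (p677563); OPEN stubs 5 unchanged by name; registered by planner ad-ideate-p1 g25) ; v9 (= v8 with `stub_windowFactsH` DISCHARGED in-skeleton by the landed final assembly `windowFactsH_of_inputs`, p672353, from TWO new registered stubs `stub_effectiveFrameEnergyL` (W3-E, split v28 §4c verbatim; holder ad-k3l-bookkeeping-p1) and `stub_cellInputs` (split v28 §9 verbatim; W4/W5/W6/(X_G⁺)/(M♭_G)); OPEN stubs 5: cellLawV0_IS, effectiveFrameEnergyL, cellInputs, compactRange, largeR; registered by planner ad-ideate-p1 g25, 2026-08-28T22:2xZ) ; v8 (= v7 with W7 piece 1 `stub_classReduction` DISCHARGED in-skeleton by the landed `classReduction_of_pos`, p668138; OPEN stubs 4: cellLawV0_IS, windowFactsH, compactRange, largeR) ; v7 = v6′ with ONE extra binder `(hlo : 0 < lo)` in `stub_classReduction`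 (w1 g3 stub-misstated 21:06:49Z / D25-10) ; v6′ = v6 with the trim level PINNED in `stub_windowFactsH` (F-lead-10 / D25-8) ; v6 = v5 (W7 three-piece re-cut, designer p5 g9, `ClassDecayW` pair clause D25-5) ⊕ the lead's v5-candidate
# (S23‴ re-cut at the OPERATOR level, lead-k1l-onelevel-p1 g3, tree `Lines/onelevel_v5_candidate.lean` 6dbcaa49c5e26a4f): tenure planner ad-ideate-p1 g25, D25-6.
`stub_windowDefectH` (S23‴, Kb-fix text 67be95a17dc9ee1d, l.358 of v4′) is now PROVED in-skeleton as `windowDefectH_of_windowFacts stub_windowFactsH`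
(glue LANDED sorry-free: `Theorems/…LagrangianStepWindowDefectHGlue.lean` p665050 over `…LedgerSplitSlopWindow` p663286, `…LedgerSplitSlop` p664182,
`…LedgerTransfer` p664495, `…LedgerGrid` p664651; the glue's `example` checks the S23‴ text verbatim).  NEW registered stub `stub_windowFactsH` (XL−, holder:
the line lead) = the per-window OPERATOR facts (Z)/(Hi)/(Rec) over an abstract orthogonal three-way label splitting `P ⊕ Q₁ ⊕ Q₂` of `V2` — text verbatim
from the lead's candidate (its docstring below carries the architecture and the review asks R1–R3 answered by «control» p4).  OPEN stubs after v6 = sorries = 5: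
`stub_cellLawV0_IS` (XL, W1–W6 cell/frame analysis), `stub_windowFactsH` (XL−, lead), `stub_classReduction` (M), `stub_compactRange` (L), `stub_largeR` (XL, W7 seat).
Composition `LagrangianRenormalisationStepDesign_of` byte-identical to v4′/v5; `lean check`: rc 0, sorries 5, conclusion BY NAME.  NOT a proof of AD; rung F-D1.A0.
-/

/-!
# v5 (= v4′ with W7 `stub_highLabelDecay_IS` RE-CUT into `stub_classReduction` (M) + `stub_compactRange` (L) + `stub_largeR` (XL) — p5 g9 text, tenure D25-4; the W7 text itself is now PROVED in-skeleton;
# open registered stubs = {`stub_cellLawV0_IS`, `stub_windowDefectH`, `stub_classReduction`, `stub_compactRange`, `stub_largeR`}; composition `LagrangianRenormalisationStepDesign_of` unchanged; new import DefsW7)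
# K1L_D skeleton «onelevel-design» v4′ (= v4 with the inline glue block replaced by the import of the LANDED `…OneLevelSplitGlueH`; stub texts byte-identical to v4 98fc8a8d986fe34c)
# v4 (= v3 with the window stub RE-CUT at the high-label interface: S23″ `stub_windowDefectL` ↦ S23‴ `stub_windowDefectH` + W7 `stub_highLabelDecay_IS`,
glued by `GlueH.oneLevelL_IWH_of_piecesH` / `GlueH.chainLower_of_oneLevel_at` (inline, sorry-free; Theorems landing asked); OPEN stubs = sorries = 3:
`stub_cellLawV0_IS` (XL), `stub_windowDefectH` (XL−, holder lead-k1l-onelevel-p1), `stub_highLabelDecay_IS` (XL−, flat; p4 g12 text); item stmt-AnomalousDissipation-27980;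
REGISTERED by the tenure planner ad-ideate-p1 g25, 2026-08-28; supersedes v3 sha16 ace991410aa3c053)

WHY v4 (tenure D24-22/D24-23/D25-1; p4 g12 F-p4g12-4, lead F-lead-9): S23″'s per-window defect decomposition asked for a dissipation-dominated (DD) bound
`|⟨y, e_j⟩| ≤ η √(drop_j) √(‖y‖² − ‖T_j* y‖²)` for EVERY test vector `y`; at each frame reset the cell-scale correctors are re-read with their Bloch label
scrambled onto fibres beyond the homogenisation range of (V) and below the bare per-window viscous kill, where no typed clause controls them — (DD) ∀y is not
provable from (V)(C)(F)(X).  The missing flat input is ν-UNIFORM decay of the cell dynamics on HIGH Bloch labels (enhanced dissipation in the shear slots):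
clause (H) `HighLabelDecayW W M hM lo hi Λ β νh Kb CK cK` (DefsH).  The re-cut:
* S23‴ `stub_windowDefectH` (text of record = p4 g12 `windowDefectH_textKb`, `Cruxes/LagrangianRenormalisationStep/Lines/onelevel_S23H_Kbfix.lean` 095ac2fbf155, block sha16
  67be95a17dc9ee1d; tenure D25-1): hypotheses of S23″ + the decay FAMILY `(∀ Kb ≥ 1, ∃ CK ≥ 1, ∃ cK > 0, ∃ νh > 0, HighLabelDecayW W M hM lo hi Λ β νh Kb CK cK)`
  (∀Kb∃-form: a larger `Kb` is a LOWER label threshold = a stronger clause, and the stub must be free to take `Kb ≥ K/c_V` — F-p4g12-5); conclusion: trim level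
  `Lc` with the export `R ≤ Cτ ρ^στ Lc² (1 − e^{−4π² kbar_m lo})`, `Cη ρ^ση ≤ 1/8`, and for every band-limited class-`R` datum the TRIMMED ENERGY COMPARISON
  `‖U¹_{0→t} x₁‖² ≤ ‖U⁰_{0→t} x₁‖² + Cη ρ^ση (‖x₁‖² − ‖U⁰_{0→t} x₁‖²)` on `t ∈ (1/2,1)` (the window ledger now runs inside the stub).
* W7 `stub_highLabelDecay_IS` (p4 g12 `Lines/onelevel_highLabelDecay.lean` text over the LANDED def): (H) for the DESIGN word `cubatureWord`, every `M > 0`, every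
  window and every `Kb ≥ 1` — design-specific on purpose ((H) at every word is false: a word with an unsheared polarisation has no enhancement).
* IW_H `stub_oneLevelL_IWH` (derived, no sorry): the v3 `stub_oneLevelL_IW` text with the same (H) line inserted after its (F) line, `:= GlueH.oneLevelL_IWH_of_piecesH
  stub_windowPropagatorL stub_windowDefectH`; the chain is glued AT THE DESIGN WORD by `GlueH.chainLower_of_oneLevel_at stub_baseT … (stub_oneLevelL_IWH 26 cubatureWord …
  (stub_highLabelDecay_IS M hM lo hi ΛV β …))` (the landed `chainLower_of_pieces_ISW` wants the one-level text at every word; (H) exists only at the design).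
* The two glue theorems (namespace `…OneLevel.GlueH`, `lean check` rc 0 / 0 sorry / axioms {propext, Classical.choice, Quot.sound} as the stand-alone Theorems-ready file
  HOME/ad-ideate-p1/r25/v4/SolenoidalFractalHomogenisationLagrangianStepOneLevelSplitGlueH.lean) are INLINE here exactly as v18–v21 were; when a prover lands that file
  (`--kind proof --supports stmt-AnomalousDissipation-27980 --as helper`) v4′ swaps the block for the import — stub texts unchanged, credits carry.
* `stub_windowDefectL` (S23″) LEAVES the registry (never repaired in place; its finding F-p4g12-4 is the reason for the re-cut).  Everything else = v3 verbatim.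
`lean check`: rc 0, sorries 3 (= open stubs), conclusion = the route decl BY NAME (`LagrangianRenormalisationStepDesign_of`).  NOT a proof of AD; rung F-D1.A0 unchanged.

--- v3 header (kept for the record) ---
-/

/-!
# K1L_D skeleton «onelevel-design» v3 (= v2′ + `stub_oneLevelL_IW` split into stub_windowPropagatorL [discharged p648539] / stub_windowDefectL, discharged via the landed glue `oneLevelL_IW_of_piecesL`; OPEN stubs = sorries = 2: stub_cellLawV0_IS, stub_windowDefectL) — crux `LagrangianRenormalisationStepDesign` (rev 18/19 of route-AnomalousDissipation-SolenoidalFractalHomogenisation,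
item stmt-AnomalousDissipation-27980; REGISTERED by the tenure planner ad-ideate-p1 g24, 2026-08-28; supersedes v1′ sha16 dcee387968b3051b)

v2 = v1′ with the THREE RE-CUTS OF RECORD (tenure D24-2 (c) / D24-3 / D24-4 / D24-5), registered now that the landing list F0–F3 is in the tree
(`…LagrangianStepCellClauseCutsW` F0, `…OneLevelDefsFamily`/`…OneLevelDefsSectorial` F1, `…CellClauseCutsFamily` F2, `…OneLevelGlueLowerFamily` +
`…OneLevelGlueLowerFamilyGlue` F3 — all landed by ad-k3l-bookkeeping-p1 g3 from planner ad-ideate-p4 g9/g10's sketches) and the lead consents (13:25:51Z, 14:04:51Z):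
* `stub_cellEnergyT` (L; NAME KEPT, text re-cut (F) → (F_T)): conclusion `CellEnergyClausesWNoE` (window-local growth factor `exp(C·L²t/(n²ν))`; the uniform-in-T
  clause (F) has a growing mode, F-lead-1 / B-lead-1.md) — PROVED by the lead as `cellEnergyT_W` (p639427), to be closed by name against this text.
* `stub_oneLevelL_IW` (XL−; replaces `stub_oneLevelL`): the `hone` binder of the LANDED `chainLower_of_pieces_ISW` VERBATIM — ν-dependent shape FAMILY `Φ : ℝ → Visc4 → Visc4`
  read at `ν = E.cellVisc (m+1)`, window facts on `S` AND on its image supplied as hypotheses (no `WindowClause`), slow-vector clause `SlowVectorClauseF`, cell-energy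
  clauses in the window-local typing `CellEnergyClausesW`, NO existence conjunct (existence is `existsL_tensor`, inside the landed glue).
* `stub_cellLawV0_IS` (XL; replaces `stub_cellLawV0`): planner p4's `stub_cellLawW_IS` text at W₀ := `cubatureWord` under `ScalarLawBlock cubatureWord c0` — the (V) data as a
  SECTORIAL × DEFECT interval window family `SectorialIntervalWindowFamily Φ μ Sstar slo shi lam₀ Λ Λc Λ' τlo τhi τc β lo hi ΛV` (each `Φ ν` has its own centre; the single
  ν-free `Φ` with `WindowClause` of v21/v1′ is marginal-to-false at W₀, F-p4g9-1 / F-p5g4-2) and the slow-vector law WITHOUT existence `SlowVectorClauseNoExF`.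
* `stub_gainPackageW0` is now DISCHARGED by name (p639096); `stub_tailL` (p635434), `stub_existsL`, `stub_baseT`, `stub_cascadeT` as in v1′.  OPEN stubs = sorries = 3.
* Composition `LagrangianRenormalisationStepDesign_of`: cellLawV0_IS → `slowVectorClauseF_of_noExF_familyS` → cellEnergyT → `cellEnergyClausesW_of_noE` →
  `chainLower_of_pieces_ISW stub_baseT stub_oneLevelL_IW` → tailL → pack → cascadeT (v1′ tail verbatim).  `lean check`: rc 0, sorries 3, conclusion = the route decl by name.

--- v1′ header (kept for the record) ---

Conclusion BY NAME: `Summit.AnomalousDissipation.AnomalousDissipation.Theses.SolenoidalFractalHomogenisation.LagrangianRenormalisationStepDesign`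
(K1L for SOME design word D: `(K2R text) → ∃ k D c ν₀ K Λ₀ θ₀, ∀ E, E.design = D → … (T1)–(T5), refresh → E.RenormalisationBound`; RULING R24-1 / D24-3).
This file IS the K1L registry «onelevel» v21 (item stmt-AnomalousDissipation-24912, now an ASIDE of the route; HOME/ad-ideate-p1/r23/onelevel_v21.lean sha16
82e0407c6f9511aa) SPECIALISED to the design D := W₀.stretch M hM, W₀ = `…Theorems.cubatureWord` (k = 26, c0 = 7/(4960π⁴); K2R's witness p608013):
* OPEN stubs (sorries = 4): `stub_gainPackageW0` (S: `ScalarLawBlock cubatureWord c0` — K2R's realised bracket law re-derived for W₀ by name from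
  `Theorems/SolenoidalFractalHomogenisationRealisedQuasiStaticCellLaw*.lean`; provable now) · `stub_cellLawV0` (XL: the v21 (V) text `… SlowVectorClauseNoEx W M hM c Φ …`
  at W := cubatureWord, hypothesis `ScalarLawBlock cubatureWord c0`; the general v21 `stub_cellLawV` implies it by instantiation) · `stub_cellEnergyT` (L; v21 text
  BYTE-IDENTICAL, conclusion `CellEnergyClausesNoE`; lead lead-k1l-onelevel-p1: (F) → (F_T) re-cut D24-4 rides in v2) · `stub_oneLevelL` (XL−; v21 text BYTE-IDENTICAL; lead).
* DISCHARGED by name (imports): `stub_existsL` p611352 · `stub_baseT` p612457 · `stub_cascadeT` (GlueLower p629119 / p614475) · `stub_tailL` p635434 (ad-k3l-bookkeeping-p1 g3).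
* Composition `LagrangianRenormalisationStepDesign_of`: intro the K2R hypothesis (unused: the design is fixed to W₀ and its gain package is `stub_gainPackageW0`),
  then the v21 chain verbatim at (26, cubatureWord): cellLawV0 → `slowVectorClause_of_noEx` → cellEnergyT → `chainLower_of_pieces stub_baseT (oneLevel_of_oneLevelNoExists stub_oneLevelL)`
  → tailL → pack ⟨26, W₀.stretch M hM, c, ν₁, K₁, max Λ₀ Λ₁, min θ₀ θs, …⟩ → cascadeT.  `lean check`: rc 0, sorries 4 (= open stubs), conclusion = the route decl by name.
* v2 (registered when F0–F3 of the 13:04:46Z landing list are LANDED Theorems and nothing of the lead is in flight): `stub_cellEnergyT` ↦ conclusion `CellEnergyClausesWNoE`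
  ((F_T), lead 13:25:51Z), `stub_oneLevelL_I` (hypothesis `CellEnergyClausesW`, interval-window family, p4 g9 D24-2), `stub_cellLawV0_IS` (defect family × sectorial guard,
  p4 `stub_cellLawW_IS` at W₀), composed through `cellEnergyClausesW_of_noE` + `chainLower_of_pieces_IS`.
Helper landings: `--supports stmt-AnomalousDissipation-27980 --as helper`; by-name closures must match the stub NAME and SIGNATURE registered here.
-/

/-!
v21 (REGISTERED by tenure planner ad-ideate-p1 g23, 2026-08-28 ~11:35Z gate time) = p4 g7's v20+v21 candidates (findings F-p4g7-3 and F-p4g7-4, `BirthV21Candidate.lean`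
sha16 2763d65f9e915721) with ALL FOUR inline sorry-free blocks (one-sided chain glue v18 · renormalised-level existence v19 · (V)-no-existence v20 · (F)-no-energy v21)
REPLACED BY IMPORTS of the files landed by the line lead `lead-k1l-onelevel-p1` g0 as its FIRST ACT: p629119 `Theorems/…LagrangianStepOneLevelGlueLower.lean`,
p629134 `Theorems/…LagrangianStepCellClauseCuts.lean` (both ACCEPTED ≈11:30Z).  Open stubs: tailL (L; v17 text) · cellLawV (XL; conclusion `SlowVectorClauseNoEx`) ·
cellEnergyT (L; conclusion `CellEnergyClausesNoE`) · oneLevelL (XL−; v19 text).  Closed by name: existsL p611352, baseT p612457; cascadeT proved from GlueLower.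
There is no separate v20 registry (v20 and v21 cuts registered together).  p4's candidate notes follow for the record.
-/

/-!
v21 CANDIDATE (ideator planner ad-ideate-p4 g7, 2026-08-28, finding F-p4g7-4 — NOT registered; for the tenure planner; stacks on the v20 candidate; same SHARED-DEFS caveat:
adoptable once `CellEnergyClausesNoE` + lemmas land in `Theorems/…LagrangianStep…`): = v20 with the ENERGY-INEQUALITY sub-conjunct
`∫ x, ‖u t x‖ ^ 2 ≤ ∫ x, ‖F x‖ ^ 2 ∧` of clause (F) removed from `stub_cellEnergyT`: its conclusion now ends in `CellEnergyClausesNoE` (local def =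
landed `CellEnergyClauses` VERBATIM minus that conjunct), and the composition feeds `stub_oneLevelL` the FULL clauses through the proved
`cellEnergyT_of_cellEnergyTNoE` (Literature `Torus.IsWeakTensorPassiveVectorOn.ae_energy_ineq` [Temam1984 III §1 Lemma 1.2] + window ellipticity of
`(1/n²)•𝔸` + K2R's `memLp_top_stLift_cell` (the cell carrier IS a `LatticeWord.cell`) + `IsDatum F` ⇒ `L²`, div-free).  A weakening; one token in the
composition.  `lean check`: rc 0, sorries 4.  Typed sketch: `Cruxes/LagrangianRenormalisationStep/CellEnergyTNoESketch.lean`.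
-/

/-!
v20 CANDIDATE (ideator planner ad-ideate-p4 g7, 2026-08-28, finding F-p4g7-3 — NOT registered; for the tenure planner; stacks on the v19 candidate):
= v19 with the EXISTENCE sub-conjunct of the slow-vector clause (V) removed from `stub_cellLawV`: its conclusion now ends in `SlowVectorClauseNoEx`
(local def = landed `SlowVectorClause` VERBATIM minus `(∃ v, IsWeakTensorPassiveVectorOn 0 (2T) (effective tensor) 0 (Re e_ℓ • p) v) ∧`), and the
composition feeds `stub_oneLevelL` the FULL clause through the proved `cellLawV_of_cellLawVNoEx` (window clause ⇒ ellipticity of the effective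
tensor `nearIso_effTensor` ⇒ Lions carrier-free existence `Torus.exists_isWeakTensorPassiveVectorOn_zero_carrier` (Literature, Amendment 1 of
2026-08-28, written for this conjunct) from the single-mode datum (K2R's `memSobolev_one_singleMode`, `isWeaklyDivFree_singleMode`)).  A weakening;
one token in the composition; the Floquet–Bloch prover of cellLawV no longer owes a PDE-existence statement.  `lean check`: rc 0, sorries 4.
Typed sketch: `Cruxes/LagrangianRenormalisationStep/CellLawVNoExSketch.lean`.
-/

/-!
v19 CANDIDATE (ideator planner ad-ideate-p4 g7, 2026-08-28, finding F-p4g7-2 — NOT registered; for the tenure planner): = v18 with the EXISTENCE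
conjunct `(∃ v, TSol E m (k̄_m • renormStep Φ g S) w₀ v) ∧` of `stub_oneLevelL` DELETED (a weakening; every other binder byte-identical).
It is J.-L. Lions' theorem, in the Literature since `PassiveVectorTensorLionsExistence.lean` (`Torus.exists_isWeakTensorPassiveVectorOn`, any
`NearIso 𝔸 lo hi`, `lo > 0`, bounded a.e.-div-free carrier — its docstring names this consumer), + `renormStep_window` (p614475) + `NearIso.smul`
+ the partial-sum carrier package of p611352: proved below in «## Existence of the renormalised level-m problem» (`nearIso_smul_renormStep`,
`existsL_tensor`, `existsL_renorm`, adapter `oneLevel_of_oneLevelNoExists` : v19-statement → v18-statement); the composition changes by ONE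
token (`stub_oneLevelL` ↦ `(oneLevel_of_oneLevelNoExists stub_oneLevelL)`).  Active stubs: tailL (L) · cellLawV (XL) · cellEnergyT (L) ·
oneLevelL (XL−, now = the one-sided drop-ratio comparison ALONE).  `lean check`: rc 0, sorries 4.  Typed sketch:
`Cruxes/LagrangianRenormalisationStep/ExistsRenormSketch.lean`.
-/

/-!
v18 (REGISTERED by tenure planner ad-ideate-p1 g23, 2026-08-28 ~11:00Z gate time; re-cut AUTHORED by ideator planner ad-ideate-p4 g7, finding F-p4g7-1, adopted verbatim from Cruxes/LagrangianRenormalisationStep/BirthV18Candidate.lean sha16 29f19bd9e721f02e): = v17 with the UNCONSUMED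
upper drop ratio deleted.  `cascade_of_chain_abstract` (p609829) never uses `drop u ≤ (1 + Cρ^σ) drop v` (it destructures `⟨⟨_, hlow, _⟩, …⟩` /
`ht.2.1`) and `Cascade` is one-sided, so (i) `stub_oneLevelL` loses the last line of its conclusion (a WEAKENING: v17's stub implies v18's by
dropping a conjunct — every other binder byte-identical), (ii) `stub_cascadeT` reads `ChainLower E → Cascade E` (still discharged, by the inlined
`cascade_of_chainLower` = the landed telescoping proof with the unused hypothesis conjunct removed), (iii) the composition calls
`chainLower_of_pieces` (= landed `chain_of_pieces` verbatim, last line `⟨…, h1⟩` instead of `⟨…, h1.1, h1.2⟩`).  The block «## One-sided chain glue»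
below is sorry-free and is meant to be LANDED as `Theorems/SolenoidalFractalHomogenisationLagrangianStepOneLevelGlueLower.lean` (same content, namespace
`…Theorems.SolenoidalFractalHomogenisation.LagrangianStep`) and then replaced by an import, exactly as v15 did for v10's glue.  Active stubs unchanged in
number and names: tailL (L) · cellLawV (XL) · cellEnergyT (L) · oneLevelL (XL−, now ONE-SIDED = the decay direction `‖u(t)‖² ≤ ‖v(t)‖² + Cρ^σ·drop v`).
Idea card: `Cruxes/LagrangianRenormalisationStep/Ideas/signed-corrector-ledger.md`; typed sketch `…/OneSidedChainSketch.lean`.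
-/

/-!
v17 (TENURE RE-CUT by planner ad-ideate-p1 g23, 2026-08-28T11:1xZ, after ideator planner ad-ideate-p4 g6's finding F-p4g6-1 / K3L card
`Cruxes/LagrangianCarrierConstruction/Ideas/distortion-trapping-ceiling.md`, and in lock-step with K3L skeleton v8): = v16 with ONE stub re-cut —
`stub_tailL` becomes `∀ k (W : LatticeWord k), ∃ Λ₁ : ℕ, ∃ θs : ℝ, 0 < θs ∧ ∀ E, E.design = W → … → ∀ θ₀ : ℝ, θ₀ ≤ θs → (T4 θ₀) → …` (the prover CHOOSES a
design-dependent separation `Λ₁` AND strain-budget ceiling `θs`; the other binders byte-identical to v16), and the composition instantiates K1L's `∃ θ₀ > 0`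
at `min θ₀ θs` (`θ₀` from `stub_oneLevelL`; (T4) is monotone in the budget, so the chain gets its clause at `θ₀` and the tail stub its clause at `θs`).  WHY: the
uniform flow-distortion bound for the levels above `j` that the tail estimate needs is, by the norms-only frame recursion, available only under a smallness of the
strain budget (K3L v8 docstring); v16 asked it for every `θ₀`.  Zero cost to the crux.  `stub_cellLawV`, `stub_cellEnergyT`, `stub_oneLevelL`, the by-name stubs
and everything else: unchanged from v16 (sha16 fea4db9d5ee35e0e).

v16 (TENURE RE-CUT by planner ad-ideate-p1 g23, 2026-08-28, RULING R23-1): = the lead's registered v15 (prover ad-solenoidal-k2r-lowerlaw-p1 g5,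
sha16 fe847e2361999376: v14 with the local blocks «## v10 definitions» + re-cut check + «## Proved glue» replaced by the imports of the landed
`Theorems/…LagrangianStepOneLevelDefs.lean` (p613864) and `Theorems/…LagrangianStepOneLevelGlue.lean` (p614475)), with ONE stub re-cut:
`stub_tailL` now also receives the K1L template hypotheses that make the tail small — `N m ^ 2 ≤ N (m+1)`, (T2) `cellVisc (m+1)·(N (m+1)/N m)^{1/4} ≤ 1`
(together: `cellVisc (m+1) ≤ N m ^ (-1/4) → 0`) and (T4) `θ (m+1)·(N (m+1)/N m)^{1/16} ≤ θ₀` for an arbitrary `θ₀` (bounded strain budgets ⇒ bounded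
flow distortion on refresh windows, `Theorems/…LagrangianCarrierDistortion.lean` p615383) — binder texts byte-identical to K1L's; the composition feeds them
from its own binders (`htail k E hP hR hsep1 hsq h2 θ₀ h4 …`).  WHY (R23-1): from `LPermissible ∧ Regular ∧ lacunarity` alone the stream-potential tail ratio
`‖ψ_{>j}‖_∞ / kbar j` is only BOUNDED (`≤ (1+θ)²/(8π²√gain)` per level: `Permissible` allows `cellVisc m ≡ ν* < nu0`), not → 0, so v15's `stub_tailL` had no
perturbative proof; with (T2)+(N²) it is `≲ D(θ₀)² · sup_{m>j} cellVisc m / gain → 0` and the landed stream-form stability lemma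
`Literature/…/PassiveVectorTensorStreamStability.lean` (p615321, `ae_integral_norm_sq_le_add_of_stream`) closes the PDE half.  The other three ACTIVE stubs
`stub_cellLawV` · `stub_cellEnergyT` · `stub_oneLevelL` and the three discharged ones are byte-identical to v14/v15 (credits carry).  `lean check`: rc 0, sorries 4 (the active stubs).

HISTORY (v14 note, kept):
v14 (FALLBACK COPY by tenure planner ad-ideate-p1 g22, 2026-08-28T07:3xZ): = tree Lines/onelevel.lean v13 (sha 6054c786, cstrat-24912) with `stub_baseT`
DISCHARGED BY NAME from `…Theorems.SolenoidalFractalHomogenisation.LagrangianStep.stub_baseT` (p612457, lead g5). Active stubs: tailL, cellLawV, cellEnergyT, oneLevelL.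
Everything else byte-identical. If cstrat registers its own v14 first, this file is NOT registered.
 # Line `onelevel` (crux-strategist, unit `cstrat-stmt-AnomalousDissipation-24912-g0`, 2026-08-28) — skeleton v13 for the crux
`LagrangianRenormalisationStep` (K1L, item `stmt-AnomalousDissipation-24912`, rank 2) of route `SolenoidalFractalHomogenisation` (rev 14).
Anomalous dissipation is NOT claimed: the route closes rung F-D1.A0 (`…Theses.SolenoidalFractalHomogenisation.Target`), not the summit.

**What this line changes relative to the registered birth line** (r22 v12 of the tenure seat = r17 v9 over the shared defs p610007, with `stub_cascadeT` DISCHARGED by name from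
`…Theorems.SolenoidalFractalHomogenisation.LagrangianRenormalisationStep.cascade_of_chain` (p609829) and `stub_existsL` DISCHARGED by name from
`…Theorems.SolenoidalFractalHomogenisation.LagrangianStep.stub_existsL` (p611352); 4 active stubs baseT · tailL · cellLawT · chainL).  The XL PAIR `stub_cellLawT` / `stub_chainL`
is re-cut; the other stubs `stub_baseT`, `stub_tailL` (sorried) and `stub_existsL`, `stub_cascadeT` (stated and discharged by name exactly as in r22 v12) are
BYTE-IDENTICAL to v9/v12 (names + signature text), and the
v9 definitions block (v9 l.94–281: `VF`, `IsDatum`, `InClass`, `FullSol`, `drop`, `TSol`, `slotWeight`, `mhat`, `excShape`, `taylorShape`,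
`AnisotropyWindow`, `ScalarLawBlock`, `cellField`, `modeCoeff`, `sectorEnergy`, `lowEnergy`, `TensorCellPackage`, `Chain`, `Cascade`) is no longer
local: it is IMPORTED from the landed shared defs file `Theorems/SolenoidalFractalHomogenisationLagrangianStepDefs.lean` (p610007, commit
c83170635324; namespace `…Theorems.SolenoidalFractalHomogenisation.LagrangianStep`, opened below) exactly as the K1L SHARED-DEFS RULE asks of the
strategist seat (STATUS 2026-08-28T06:12:30Z / 06:52:20Z: «skeleton v10 = v9 with l.94–281 replaced by import + open; stub text unchanged ⇒ credits
carry over»), so the by-name landings (done: `stub_existsL` p611352 ad-prover-2 g8, `cascade_of_chain` p609829 g5; in flight: `stub_baseT`, lead k2r-lowerlaw-p1 g5)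
elaborate against THE SAME declarations as this skeleton.

1. `stub_chainL` (the renormalised tensor chain, ALL levels at once, intermediate tensors hidden behind `∃ 𝔸 : ℕ → Visc4`) becomes ONE local stub
   plus PROVED glue.  The intermediate tensors are NAMED: with the package's large-gain shape map `Φ` and the relative gains
   `g_i = gain / cellVisc_i²`, the exact Taylor recursion of `Permissible` (`kbar m = kbar (m+1)·(1 + g_{m+1})`) read at tensor level is
   `S_m = renormStep Φ g_{m+1} S_{m+1} = (S_{m+1} + g_{m+1}·Φ S_{m+1})/(1 + g_{m+1})`, `S_j = I` (`shapeSeq`; `chainTensor E Φ j m = kbar m • S_m`) —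
   the package's effective tensor `𝔸 + (c/ν)Φ(𝔸/ν)` at `𝔸 = cellVisc_{m+1}·S_{m+1}`, `ν = cellVisc_{m+1}`, rescaled to level `m`.  All finite-`ν`,
   finite-`n`, distortion and refresh-transient effects are booked in the DROP-RATIO error `C ρ_m^σ`, never in the tensors; hence WINDOW PROPAGATION
   IS PROVED (`shapeSeq_window`: `renormStep` is a convex combination of `S` and `Φ S`, both in the `λ = 1` window by the window clause), and so are
   the INDUCTION over `m` and the assembly of `Chain E` (`chainL_of_pieces`).  The new stub `stub_oneLevelL` (XL−, LOCAL in the level: no `j`, no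
   chain, no window bookkeeping) is Armstrong–Vicol Prop. 5.2 / §5.3 in Lagrangian frames for ONE consecutive pair `m < m+1`: for every window shape
   `S` at level `m+1` and every class-`R` datum, a weak solution of the level-`m` problem with `kbar_m·renormStep Φ g_{m+1} S` exists, and every pair
   of weak solutions (level `m+1` with `kbar_{m+1}·S`, level `m` with the renormalised tensor) has energy drops on `(1/2,1)` within the ratio
   `1 ± C₁ρ_m^{σ₁}` for `m ≥ m⋆(E,R)`; the constants `ν₁, K₁, Λ₀, θ₀, C₁, σ₁` are uniform in `E` (all `E`-dependence sits in `m⋆`).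
2. `stub_cellLawT` (`∃ M c, TensorCellPackage W M hM c`: shape map + invariant windows + clauses (F) fluctuation data, (V) slow-vector law,
   (C) corrector content, one constant block) becomes TWO stubs of different size and prover profile: `stub_cellLawV` (XL: the shape map `Φ`, its
   invariant windows and the SLOW-VECTOR LAW (V) with the existence of the effective solution — `SlowVectorClause`, the Floquet–Bloch heart) and
   `stub_cellEnergyT` (L: the CELL-ENERGY clauses (F) + (C) — `CellEnergyClauses` — for EVERY pre-stretch `M`, bookkeeping constant `c > 0` and
   window, with its own constants; two-scale energy estimates in the style of K2R's sector machinery, no shape map, no rate exponent).  The clause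
   texts are v9's verbatim, regrouped; `tensorCellPackage_of_clauses` PROVES that window clause + (V) + (F)+(C) with one common constant block is
   exactly v9's `TensorCellPackage` (so the re-cut transcribes nothing wrongly), and `stub_oneLevelL` consumes the two blocks with SEPARATE constants
   (no constant merging needed anywhere).

Five sorried stubs: baseT (M) · tailL (L) · cellLawV (XL) · cellEnergyT (L) · oneLevelL (XL−; hardest together with cellLawV); `stub_existsL` (S/M) and `stub_cascadeT` (M)
are stated byte-identically and PROVED by name from p611352 / p609829 (as in r22 v12), so they are no longer active stubs.
The composition `LagrangianRenormalisationStep_of` (the ONLY crux-headed theorem of the file, hypothesis-free, the seven stub decls consumed by name) is v9's proof re-fed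
(kernel-checked): `chain_of_pieces stub_baseT stub_oneLevelL` builds `Chain E` from the two clause blocks.  `lean check`: sorries only inside `stub_*`.

NEW DEFINITIONS occurring in the new stub signatures: `renormStep`, `WindowClause`, `SlowVectorClause`, `CellEnergyClauses` (and, in the
proved glue only, `shapeSeq`, `chainTensor`).  SHARED-DEFS RULE for them (the strategist names the file): the FIRST landing against any of
`stub_cellLawV` / `stub_cellEnergyT` / `stub_oneLevelL` is the defs-only sibling file
`Theorems/SolenoidalFractalHomogenisationLagrangianStepOneLevelDefs.lean` (imports `…LagrangianStepDefs`; SAME namespace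
`…Theorems.SolenoidalFractalHomogenisation.LagrangianStep`; the block `## v10 definitions` below copied VERBATIM — names, bodies, binder order;
`--supports stmt-AnomalousDissipation-24912 --as helper`); then the tenure/strategist seat re-registers v11 = this file with that block replaced by the
import (stub text unchanged ⇒ credits carry over). -/

set_option linter.dupNamespace false

namespace Summit.AnomalousDissipation.AnomalousDissipation.Cruxes.LagrangianRenormalisationStepDesign.OneLevel

open Literature.Analysis Literature.Analysis.FluidPDE Literature.Analysis.FunctionSpaces
open MeasureTheory Set Filter
open scoped ENNReal NNReal InnerProductSpace

noncomputable section

open Summit.AnomalousDissipation.AnomalousDissipation.Theses.SolenoidalFractalHomogenisation (LagrangianRenormalisationStep)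
open Summit.AnomalousDissipation.AnomalousDissipation.Theorems.SolenoidalFractalHomogenisation.LagrangianStep

/-! ## Definitions of the registered v9 skeleton: IMPORTED (K1L SHARED-DEFS RULE)
`VF IsDatum InClass FullSol drop TSol slotWeight mhat excShape taylorShape AnisotropyWindow ScalarLawBlock cellField modeCoeff sectorEnergy lowEnergy
TensorCellPackage Chain Cascade` come from `Summits.AnomalousDissipation.AnomalousDissipation.Theorems.SolenoidalFractalHomogenisationLagrangianStepDefs`
(p610007; v9 l.94–281 verbatim) via the `open … LagrangianStep` above — nothing is redeclared here. -/

/-! ## v10 definitions `renormStep shapeSeq chainTensor WindowClause SlowVectorClause CellEnergyClauses` and the re-cut check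
`tensorCellPackage_of_clauses` / `clauses_of_tensorCellPackage`: IMPORTED since v15 from `…Theorems.SolenoidalFractalHomogenisationLagrangianStepOneLevelDefs`
(p613864) and `…OneLevelGlue` (p614475), same namespace `…LagrangianStep` (opened above) — nothing is redeclared here. -/

/-! ## v18–v21 inline blocks LANDED (lead-k1l-onelevel-p1 g0: p629119 `…LagrangianStepOneLevelGlueLower`, p629134 `…LagrangianStepCellClauseCuts`) and IMPORTED:
`ChainLower`, `chainLower_of_chain`, `cascade_of_chainLower(_abstract)`, `cascade_of_chain'`, `chainLower_of_pieces`, `nearIso_smul_renormStep`, `existsL_tensor`,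
`existsL_renorm`, `oneLevel_of_oneLevelNoExists` (GlueLower); `SlowVectorClauseNoEx`, `CellEnergyClausesNoE`, `slowVectorClause_of_noEx`, `cellEnergyClauses_of_noE`,
`cellLawV_of_cellLawVNoEx`, `cellEnergyT_of_cellEnergyTNoE` (CellClauseCuts) — K1L SHARED-DEFS RULE honoured: every decl in an open stub's signature is a landed tree decl. -/
open Summit.AnomalousDissipation.AnomalousDissipation.Theorems.SolenoidalFractalHomogenisation.LagrangianRenormalisationStep


/-! ## Registered stubs -/

/-- (M; DISCHARGED by name from p611352, ad-prover-2 g8, exactly as in the tenure seat's r22 v12 — statement byte-identical) Weak solutions of the top-level truncated problem exist for admissible data. -/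
theorem stub_existsL : ∀ k (E : LatticeShear.LagrangianLatticeCarrier k), E.LPermissible → E.Regular →
    ∀ (m : ℕ) (w₀ : VF), IsDatum w₀ → ∃ u, TSol E m (Torus.isoVisc (E.kbar m)) w₀ u :=
  Summit.AnomalousDissipation.AnomalousDissipation.Theorems.SolenoidalFractalHomogenisation.LagrangianStep.stub_existsL

/-- (M) Base: a coercive constant-tensor problem along a partial sum drops a fixed fraction of the energy by `t = 1/2`
(energy identity + Poincaré on mean-zero fields). -/
theorem stub_baseT : ∀ k (E : LatticeShear.LagrangianLatticeCarrier k), E.LPermissible → E.Regular →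
    ∀ (m : ℕ) (𝔸 : Torus.Visc4 (Fin 3)) (lo hi : ℝ), 0 < lo → Torus.NearIso 𝔸 lo hi →
      ∀ (w₀ : VF) (u : ℝ → VF), IsDatum w₀ → TSol E m 𝔸 w₀ u →
        ∀ᵐ t ∂(volume.restrict (Ioo (1/2 : ℝ) 1)),
          (1 - Real.exp (-(4 * Real.pi ^ 2 * lo))) * Torus.vectorL2Sq w₀ ≤ drop w₀ u t :=
  Summit.AnomalousDissipation.AnomalousDissipation.Theorems.SolenoidalFractalHomogenisation.LagrangianStep.stub_baseT

/-- (L; DISCHARGED by name from p635434 `…Theorems.SolenoidalFractalHomogenisation.LagrangianStep.stub_tailL`, ad-k3l-bookkeeping-p1 g3, 2026-08-28T13:06:30Z — statement byte-identical to registry v21 l.209) (L) Tail (v16 re-cut of v3's additive form, RULING R23-1; v17: strain-budget ceiling `θs(k,W)`, see end of this docstring): the full carrier vs its truncation at the active level `j`, same viscosity `kbar j` — the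
energy drops are `ε‖w₀‖²`-close for `j ≥ j₂(ε)`.  Mechanism: the omitted Lagrangian levels are `∇·ψ_{>j}` with an antisymmetric stream bivector (pushed-forward
Kolmogorov-layer potentials, `|ψ_m| ≤ ‖DX_{m-1}‖²_∞ · a m/(4π² N m²)`), and `‖ψ_{>j}‖_∞ / kbar j ≲ D(θ₀)² · sup_{m>j} cellVisc m / gain → 0` BY THE TEMPLATE
HYPOTHESES NOW CARRIED (N² separation + (T2) ⇒ `cellVisc (m+1) ≤ (N m)^{-1/4}`; (T4) ⇒ `θ (m+1) ≤ θ₀` ⇒ window distortion `D(θ₀)` via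
`Theorems/…LagrangianCarrierDistortion.lean`); the PDE half is the landed stream-form energy stability `ae_integral_norm_sq_le_add_of_stream`
(`Literature/…/PassiveVectorTensorStreamStability.lean`, p615321: `drop u ≤ drop w + (2η + η²)‖w₀‖²`, `η = 3‖ψ‖_∞/(2 kbar j)`).  From `LPermissible ∧ Regular`
alone the ratio is only bounded (constant `cellVisc` is Permissible), which is why v3–v15's cut was not provable as typed.  Only the one-sided consequence
the composition needs is stated.  v17 (2026-08-28, after ideator p4 g6's finding F-p4g6-1 / K3L card `distortion-trapping-ceiling`): the uniform
window-distortion `D(θ₀)` of ALL levels above `j` is within reach of the norms-only frame recursion `d_m ≤ κ_k(1+D_{m−1})^p(1+C_{m−1})·strain_m` only under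
a STRAIN-BUDGET CEILING (trapping region `{D, C ≤ ½}` iff `κ_k(3/2)^{p+1}·θ ≤ ½`; AV's absolute `2^{−25}`, arXiv:2305.05048 Prop. 2.2); so the stub now lets
the prover CHOOSE `θs = θs(k, W) > 0` (and `Λ₁`) per design and asks (T4) only for `θ₀ ≤ θs` — zero cost: the crux's `∃ θ₀ > 0` is the composition's choice,
made at `min θ₀ θs` with `θ₀` from `stub_oneLevelL`. -/
theorem stub_tailL : ∀ k (W : Literature.Analysis.FluidPDE.LatticeShear.LatticeWord k), ∃ Λ₁ : ℕ, ∃ θs : ℝ, 0 < θs ∧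
    ∀ (E : LatticeShear.LagrangianLatticeCarrier k), E.design = W → E.LPermissible → E.Regular →
    (∀ m, Λ₁ * E.N m ≤ E.N (m + 1)) → (∀ m, E.N m ^ 2 ≤ E.N (m + 1)) →
    (∀ m, E.cellVisc (m + 1) * ((E.N (m + 1) : ℝ) / E.N m) ^ (1 / 4 : ℝ) ≤ 1) →
    ∀ θ₀ : ℝ, θ₀ ≤ θs → (∀ m, E.θ (m + 1) * ((E.N (m + 1) : ℝ) / E.N m) ^ (1 / 16 : ℝ) ≤ θ₀) →
    ∀ ε : ℝ, 0 < ε → ∃ j₂ : ℕ, ∀ j ≥ j₂, ∀ (w₀ : VF) (w u : ℝ → VF),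
      IsDatum w₀ → FullSol E j w₀ w → TSol E j (Torus.isoVisc (E.kbar j)) w₀ u →
        ∀ᵐ t ∂(volume.restrict (Ioo (1/2 : ℝ) 1)), drop w₀ u t ≤ drop w₀ w t + ε * Torus.vectorL2Sq w₀ := by
  intro k W'
  exact Summit.AnomalousDissipation.AnomalousDissipation.Theorems.SolenoidalFractalHomogenisation.LagrangianStep.stub_tailL k W'

/-- (S — PROVABLE NOW; first landing of any seat) The realised quasi-static GAIN PACKAGE of the stretched cubature word W₀ at gain `c0`
(= K2R's second conjunct with the witness exposed = `ScalarLawBlock cubatureWord c0`). Proof (12 lines over the landed K2R line files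
`RealisedQuasiStaticCellLaw.lowerLaw`, `upperLaw_of_upperSome upperSome`, `wordGainAtRate_one_mono`, `upperModeLaw_mono`) is written out as
`cubatureGainPackage_holds` in HOME/ad-ideate-p1/r24/rev18/CubatureSketch.lean (farm rc 0). This stub FIXES THE DESIGN of the line to W₀;
Plan B (negated palindrome W₁ = W₀·(−W₀^R), exactly odd-free shape maps) would replace it and `stub_cellLawV0` only. -/
-- v2: DISCHARGED by name from p639096 (`Theorems/SolenoidalFractalHomogenisationLagrangianStepGainPackageW0.lean`, ad-k3l-bookkeeping-p1 g3) — statement byte-identical.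
theorem stub_gainPackageW0 : ScalarLawBlock Summit.AnomalousDissipation.AnomalousDissipation.Theorems.cubatureWord Summit.AnomalousDissipation.AnomalousDissipation.Theorems.c0 :=
  Summit.AnomalousDissipation.AnomalousDissipation.Theorems.SolenoidalFractalHomogenisation.LagrangianStep.stub_gainPackageW0

/-! (v2…v13 docstring of `stub_cellLawV0_IS`, kept as history; the decl is now a theorem below.) (XL; v10 re-cut of v9 `stub_cellLawT`, its Floquet–Bloch heart) The SLOW-VECTOR TENSOR CELL LAW from K1L's hypotheses: for the word `W`
isotropic with nominal constant `c₀` whose realised scalar law block holds, a pre-stretch `M`, a realised bookkeeping constant `c`, a normalised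
LARGE-GAIN SHAPE MAP `Φ` with a nested family of `Φ`-invariant transverse windows (`WindowClause`: `{OddSmall β} ∩ {NearIso (lo/λ) (hi λ)}`,
`λ ∈ [1, Λ]` — finite-dimensional; satisfiable by ORDER-REVERSING monotonicity of the unnormalised excess map in the transverse Loewner order with
reciprocal bands `lo·hi ≈ 1`, not by one-step spectral contraction: the linearised shape map at the cubature word is non-normal, ‖L‖_W = 1.004,
anisotropic spectral radius ≈ 0.634 — ad-ideate-p5 k1l-shape-map-spectrum; the odd-part guard `OddSmall` is load-bearing, F17-1) and constants
`σ, C, ν₀, K` with the slow-vector law (V) (`SlowVectorClause`: S1D's sector machinery with the transverse `2×2` symbol per wave vector — K2R's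
Theorems chain is the template; amplitude DIFFERENCES from the same datum, decay-relative rate error, per-window burst term). -/
-- v2 RE-CUT (D24-2 (c)/D24-3): the (V) data as a SECTORIAL × DEFECT INTERVAL WINDOW FAMILY + the slow-vector law without existence (p4 g9 `stub_cellLawW_IS` at W₀).
/-- **STUB W₀-even `stub_W_evenSlackB` (NEW v14; E1 even certificate, holders p5 g12 spine / p1 g12 S2+N110 / p3 g7 N-points; sheet of record D26-1).**  The closed-form
EIGEN-centred even clause with slack at the branch-B point for some normalisation `a`, plus the numeric side conditions — `WCrossing.EvenSlackWindowB` verbatim. -/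
theorem stub_W_evenSlackB : ∃ a > (0:ℝ), WCrossing.EvenSlackWindowB a WCrossing.ρB :=
  WEvenCert.stub_W_evenSlackB  -- v15: DISCHARGED BY NAME (E1-LAND `…LagrangianStepWEvenCert.lean` p685575, p1 g12; = `WEvenCert.W_evenSlackB`; certificate p5 g12)

/-! (v14/v15 history) **STUB D1 `stub_D1_exactFamily`** (NEW v14; clause (i) = ν-uniform residue of the exact family against `ΦB a` in `RelSmall` currency, budget ρB, EVERY `a > 0`;
clause (ii) = the slow-vector law (V0) for the same family — w1, exact family of record D26-3).  `WCrossing.D1ExactFamily` verbatim.  v16: RE-CUT BY CLAUSE below — it is now a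
theorem in-skeleton from `stub_D1_residue` + `stub_D1_V0` via `WCrossing.D1ExactFamilyB_of_split` (p686447). -/
/-! (v16 history) **STUB D1-residue `stub_D1_residue`** (NEW v16; clause (i): ν-uniform residue of the named exact family against `ΦB a` in `RelSmall` currency on
the block window, budget ρB, every `a > 0`, ν ∈ (0, νB₁], νB₁ = 1/40).  v17: RE-CUT below at the landed pair-memory certificate — it is now a theorem in-skeleton. -/
/-! (v17 history) **STUB D1-residueTail `stub_D1_residueTail`** (NEW v17; a-free unit form; owners p1 g12 A1/A4 + p5 g14 TAIL-CERT; D26-9): the tail of the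
period-mean feedback of the truncated ξ = 0 fast block beyond its diagonal (`excQS`) and its colinear-adjacent pair memory (`D1ResidueCert.pairQS`) is
`RelSmall` of size ρT = 1/200000 relative to `excQS S`, uniformly in ν ∈ (0, 1/40], on NearIso(10/11, 11/10) × OddSectorial(≤ 1/20).  v18: RE-CUT below at
the landed tail certificate — it is now a theorem in-skeleton from `stub_D1_slotPairData` via `D1TailCert.relSmall_tail_of_table` (D26-12). -/
/-- **STUB D1-slotPairData `stub_D1_slotPairData` (NEW v18; lane A by name — owners p1 g12 (A1 structure identity III-b/III-c, A4 per-pair analytic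
bounds); certificate p5 g14 T1; D26-12).**  At every point of the block window: a SLOT-PAIR PRESENTATION `F` of the bilinear symbol of the tail
`psiStar − excQS − pairQS` on transverse pairs (`bsymb … k p q = Σ_{j j'} (e_j·k)(e_{j'}·k) F p q j j'` for `p, q ⊥ k`; pickup slot `j`, source
slot `j'`) together with a per-pair TABLE `g` of Frobenius weight `Σ g²/(wN·wN) ≤ (1/23)²` dominating it (`|F p q j j'| ≤ g j j' · √|P_j p|² · √|P_{j'} q|²`).
The certified tables are `D1TailCert.gTab` (in-slot decay; true weight 1.243·10⁻⁷, certified ≤ 1.04·10⁻⁶ ≪ (1/23)², `frob_gTab_le`) and the crude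
`D1TailCert.gTabC` (`frob_gTabC_le`); lane A closes this stub with `⟨gTab, frob_gTab_le, F, struct, bound⟩` (or `gTabC`, or any sharper table) —
`F` is free per window point, no registry-named kernel (memo `Lines/onelevel-D1-tail-cert.md` 18e26da85440: cases A–E, G₀ = 1/(16π⁴·3720),
θ_j ∈ {28.71, 91.88, 174.42} ν-free, θ_min = 32π²/11; the one new load-bearing analytic input is case E «off-fibre decay in the source slot» for the
13 adjacent non-colinear successions). -/
theorem stub_D1_slotPairData : ∀ ν ∈ Set.Ioc 0 WCrossing.νB₁, ∀ S : Torus.Visc4 (Fin 3), Torus.NearIso S (10 / 11) (11 / 10) →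
    ∀ τ ∈ Set.Icc (0:ℝ) (1 / 20), OddSectorial S τ →
      ∃ g : Fin 26 → Fin 26 → ℝ, (∑ j, ∑ j', g j j' ^ 2 / (D1TailCert.wN j * D1TailCert.wN j') ≤ (1 / 23) ^ 2) ∧
      ∃ F : (Fin 3 → ℝ) → (Fin 3 → ℝ) → Fin 26 → Fin 26 → ℝ,
        (∀ k p q : Fin 3 → ℝ, ∑ i, p i * k i = 0 → ∑ i, q i * k i = 0 →
          Torus.bsymb
            (Sideband.psiStar Summit.AnomalousDissipation.AnomalousDissipation.Theorems.cubatureWord WCrossing.MB WCrossing.MB_pos ν S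
              - excQS Summit.AnomalousDissipation.AnomalousDissipation.Theorems.cubatureWord WCrossing.MB S - D1ResidueCert.pairQS S) k p q
            = ∑ j, ∑ j', D1ResidueCert.ek j k * D1ResidueCert.ek j' k * F p q j j') ∧
        (∀ p q : Fin 3 → ℝ, ∀ j j', |F p q j j'| ≤ g j j' * (Real.sqrt (D1ResidueCert.PpSq j p) * Real.sqrt (D1ResidueCert.PpSq j' q))) :=
  D1Tail.stub_D1_slotPairData  -- v21: PROVED BY NAME (p701440, prover ad-sawtooth-k1loc-p1 g13): `⟨gTail, frob_gTail_le, tailKernel ν S, bsymb_tail_eq_slotPair, tail_bound_all⟩`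

/-- `stub_D1_residueTail` — the registered v17 text VERBATIM, now a THEOREM (v18) from `stub_D1_slotPairData` by the landed tail certificate
`D1TailCert.relSmall_tail_of_table` (any table of Frobenius weight ≤ (1/23)²; (1/23)·ρP = 1/200000; socket `relSmall_of_Nbar` + `sq_le_of_slotPair`). -/
theorem stub_D1_residueTail : ∀ ν ∈ Set.Ioc 0 WCrossing.νB₁, ∀ S : Torus.Visc4 (Fin 3), Torus.NearIso S (10 / 11) (11 / 10) →
    ∀ τ ∈ Set.Icc (0:ℝ) (1 / 20), OddSectorial S τ →
      WCrossing.RelSmall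
        (Sideband.psiStar Summit.AnomalousDissipation.AnomalousDissipation.Theorems.cubatureWord WCrossing.MB WCrossing.MB_pos ν S
          - excQS Summit.AnomalousDissipation.AnomalousDissipation.Theorems.cubatureWord WCrossing.MB S - D1ResidueCert.pairQS S)
        (excQS Summit.AnomalousDissipation.AnomalousDissipation.Theorems.cubatureWord WCrossing.MB S) (1 / 200000) := by
  intro ν hν S hS τ hτ hodd
  obtain ⟨g, hg, F, hs, hb⟩ := stub_D1_slotPairData ν hν S hS τ hτ hodd
  exact D1TailCert.relSmall_tail_of_table hg hS hτ hodd F hs hb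

/-- `stub_D1_residue` — the registered v16 text VERBATIM, now a THEOREM (v17) from `stub_D1_residueTail` by the landed certificate + glue
`D1ResidueCert.D1Residue_of_tail_unit` (p689543): ρP + ρT = 115/10⁶ + 1/200000 = 3/25000 = ρB. -/
theorem stub_D1_residue : ∀ a > (0:ℝ), ∀ ν ∈ Set.Ioc 0 WCrossing.νB₁, ∀ S, Torus.NearIso S (10/11) (11/10) →
    ∀ τ ∈ Set.Icc (0:ℝ) (1/20), OddSectorial S τ →
      WCrossing.RelSmall (WCrossing.ΨB₁ a ν S - WCrossing.ΦB a S) (WCrossing.ΦB a S) WCrossing.ρB :=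
  D1ResidueCert.D1Residue_of_tail_unit (ρT := 1 / 200000) (by norm_num)
    (by unfold D1ResidueCert.ρP WCrossing.ρB; norm_num) stub_D1_residueTail

/-- **STUB D1-V0R `stub_D1_V0R` (NEW v22 = RULING D27-1, replaces `stub_D1_V0` of v16–v21; clause (i) ⇒ clause (ii) on the SECTOR-HONEST windows).**
HYPOTHESIS = the registered `stub_D1_residue` text VERBATIM (clause (i): `RelSmall (ΨB₁ a ν S − ΦB a S) (ΦB a S) ρB` on the block window `NearIso(10/11, 11/10)`,
sectors `τ ≤ 1/20`, every `ν ∈ (0, νB₁]` — an unconditional THEOREM since v21 (lane A, `D1Tail.stub_D1_slotPairData` p701440), discharged in-skeleton below);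
CONCLUSION = the registered `stub_D1_V0` text with ONE added binder `β * ΛV ≤ lo / 20 →` (the sector guard: on the clause window `S = (1/ν)•𝔸 ∈ NearIso(lo/λ, hi·λ) ∩
OddSmall β`, `λ ∈ [1, ΛV]`, `WCrossing.window_in_sector` (p702370) gives `NearIso S (10/11) (11/10)` and `OddSectorial S (βλ/lo) ≤ 1/20`, so the hypothesis covers the
WHOLE window uniformly in `ν`; the consumer instantiates `β = τlo·(shi·Λc)`, `lo = slo/Λc` with `β·ΛV/lo ≤ τ₀ ≤ 1/20` = the `ClosedFormWindowB` fits, `WCrossing.consumer_guard`).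
It supplies the coercivity input of the T6 averaging step (F-w1g7-1): `sym(psiStar ν S) ≥ c₀|k|²|q|²`, `c₀ = (1 − ρB)·(0.97/1.1)·c_gain(W)` via `transNonneg_ΦB`/evenPinch and
the exact transverse isotropy of `ΦB` (certifier p5 g14: r̄ ≡ 0.04516).  Owner: prover ad-k1l-cellLawV-w1 lineage (g7: T4c/T4d/T5/T6′ landed p700645/p701088/p702237/p701475;
T6-apply, T7, T8 to go).  Why it might fail: as for V0 — the first-order averaging error must close at the clause's own rate `C·M·P_W·ξ²/ν²` with `σ ≤ ½`; the
binder only removes never-consumed windows (V0(∀β) ⇒ this conclusion, `D27.V0Window_of_V0`).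
SUPERSEDED (history, NOT a declaration): the v16–v21 registered text was
`stub_D1_V0 : ∀ a > (0:ℝ), ∃ c > (0:ℝ), ∀ lo hi ΛV β : ℝ, 0 < lo → lo ≤ hi → 1 < ΛV → 0 ≤ β → hi * ΛV ≤ 11/10 → 10/11 * ΛV ≤ lo →
    ∃ σ > (0:ℝ), ∃ C : ℝ, 0 ≤ C ∧ ∃ ν₀ > (0:ℝ), ∃ K > (0:ℝ),
      SlowVectorClauseNoExF Summit.AnomalousDissipation.AnomalousDissipation.Theorems.cubatureWord WCrossing.MB WCrossing.MB_pos c (WCrossing.ΨB₁ a) lo hi ΛV β σ C ν₀ K`. -/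
theorem stub_D1_V0R :
    (∀ a > (0:ℝ), ∀ ν ∈ Set.Ioc 0 WCrossing.νB₁, ∀ S, Torus.NearIso S (10/11) (11/10) →
      ∀ τ ∈ Set.Icc (0:ℝ) (1/20), OddSectorial S τ →
        WCrossing.RelSmall (WCrossing.ΨB₁ a ν S - WCrossing.ΦB a S) (WCrossing.ΦB a S) WCrossing.ρB) →
    ∀ a > (0:ℝ), ∃ c > (0:ℝ), ∀ lo hi ΛV β : ℝ, 0 < lo → lo ≤ hi → 1 < ΛV → 0 ≤ β → hi * ΛV ≤ 11/10 → 10/11 * ΛV ≤ lo → β * ΛV ≤ lo / 20 →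
      ∃ σ > (0:ℝ), ∃ C : ℝ, 0 ≤ C ∧ ∃ ν₀ > (0:ℝ), ∃ K > (0:ℝ),
        SlowVectorClauseNoExF Summit.AnomalousDissipation.AnomalousDissipation.Theorems.cubatureWord WCrossing.MB WCrossing.MB_pos c (WCrossing.ΨB₁ a) lo hi ΛV β σ C ν₀ K := by
  sorry

/-- The guarded clause (ii) UNCONDITIONALLY (v22): `stub_D1_V0R` applied to the in-skeleton theorem `stub_D1_residue`. -/
theorem D1_V0_window : ∀ a > (0:ℝ), ∃ c > (0:ℝ), ∀ lo hi ΛV β : ℝ, 0 < lo → lo ≤ hi → 1 < ΛV → 0 ≤ β → hi * ΛV ≤ 11/10 → 10/11 * ΛV ≤ lo →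
    β * ΛV ≤ lo / 20 →
      ∃ σ > (0:ℝ), ∃ C : ℝ, 0 ≤ C ∧ ∃ ν₀ > (0:ℝ), ∃ K > (0:ℝ),
        SlowVectorClauseNoExF Summit.AnomalousDissipation.AnomalousDissipation.Theorems.cubatureWord WCrossing.MB WCrossing.MB_pos c (WCrossing.ΨB₁ a) lo hi ΛV β σ C ν₀ K :=
  stub_D1_V0R stub_D1_residue

/-- `stub_D1_exactFamilyR` (v22; replaces the derived `stub_D1_exactFamily` of v16–v21): the GUARDED exact-family obligation `WCrossing.D1ExactFamilyR` for every
normalisation `a > 0`, from clause (i) (theorem) and the guarded clause (ii) by the landed R-split glue `WCrossing.D1ExactFamilyRB_of_split` (p702370). -/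
theorem stub_D1_exactFamilyR : ∀ a > (0:ℝ), WCrossing.D1ExactFamilyR (WCrossing.ΦB a) WCrossing.ρB WCrossing.MB WCrossing.MB_pos :=
  WCrossing.D1ExactFamilyRB_of_split WCrossing.νB₁_pos stub_D1_residue D1_V0_window

/-- `stub_cellLawV0_IS` — the registered v2…v13 text VERBATIM, a THEOREM since v14 (W-crossing glue); v22: derived through the guarded family `stub_D1_exactFamilyR`
(`WCrossing.cellLawV0_IS_of_W_D1R`, p702370) — the window instance consumed satisfies the guard (`WCrossing.consumer_guard`). -/
theorem stub_cellLawV0_IS : ScalarLawBlock Summit.AnomalousDissipation.AnomalousDissipation.Theorems.cubatureWord Summit.AnomalousDissipation.AnomalousDissipation.Theorems.c0 →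
    ∃ M : ℝ, ∃ hM : 0 < M, ∃ c > (0:ℝ), ∃ Φ : ℝ → Torus.Visc4 (Fin 3) → Torus.Visc4 (Fin 3), ∃ μ : ℝ → ℝ,
      ∃ Sstar : Torus.Visc4 (Fin 3), ∃ slo shi lam₀ Λ Λc Λ' τlo τhi τc : ℝ,
      ∃ lo > (0:ℝ), ∃ hi : ℝ, lo ≤ 1 ∧ 1 ≤ hi ∧ ∃ ΛV > (1:ℝ), ∃ β ≥ (0:ℝ),
      SectorialIntervalWindowFamily Φ μ Sstar slo shi lam₀ Λ Λc Λ' τlo τhi τc β lo hi ΛV ∧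
      ∃ σ > (0:ℝ), ∃ C : ℝ, 0 ≤ C ∧ ∃ ν₀ > (0:ℝ), ∃ K > (0:ℝ), SlowVectorClauseNoExF Summit.AnomalousDissipation.AnomalousDissipation.Theorems.cubatureWord M hM c Φ lo hi ΛV β σ C ν₀ K :=
  WCrossing.cellLawV0_IS_of_W_D1R stub_W_evenSlackB stub_D1_exactFamilyR  -- v22: through the GUARDED family (D27-1 R-glue p702370); registered text above UNCHANGED

/-- (L; v10 re-cut of v9 `stub_cellLawT`, its energy half) The CELL-ENERGY CLAUSES for EVERY pre-stretch `M`, bookkeeping constant `c > 0` and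
window `(lo, hi, Λ, β)`: constants `C, ν₀, K` (depending on `W, M, c` and the window) with (F) — cell-scale class data generate solutions along
the cell carrier with non-increasing energy (uniqueness for coercive constant tensors + bounded carriers, `PassiveVectorTensorUniqueness`
p607939, puts every weak solution in the energy class) whose slow energy `lowEnergy L` is `≤ C·(cL²/(n²ν²))·‖F‖²` (pairing with the adjoint slow
Floquet modes, whose cell-scale part has relative size `√e_f`) — and (C) — the corrector content of a slow-datum cell solution is
`≤ C·(c|ℓ|²/(n²ν²))·E₀` (two-scale energy estimate; K2R's `CoupledModeEnergyBound` road). No shape map, no isotropy, no rate exponent. -/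
-- v2 RE-CUT (D24-4/D24-5): conclusion `CellEnergyClausesWNoE` ((F_T) window-local; lead's `cellEnergyT_W` p639427 is this text).
-- v2′: DISCHARGED by name from p640158 (`Theorems/SolenoidalFractalHomogenisationLagrangianStepCellEnergyT.lean`, lead g0) — statement byte-identical.
theorem stub_cellEnergyT : ∀ k (W : Literature.Analysis.FluidPDE.LatticeShear.LatticeWord k) (M : ℝ) (hM : 0 < M) (c : ℝ), 0 < c →
    ∀ lo hi Λ β : ℝ, 0 < lo → lo ≤ 1 → 1 ≤ hi → 1 < Λ → 0 ≤ β →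
      ∃ C : ℝ, 0 ≤ C ∧ ∃ ν₀ > (0:ℝ), ∃ K > (0:ℝ), CellEnergyClausesWNoE W M hM c lo hi Λ β C ν₀ K :=
  Summit.AnomalousDissipation.AnomalousDissipation.Theorems.SolenoidalFractalHomogenisation.LagrangianStep.stub_cellEnergyT

-- v3 (cut-2; D24-7/8/11/13): `stub_oneLevelL_IW` SPLIT into S0′ `stub_windowPropagatorL` (DISCHARGED p648539) and S23″ `stub_windowDefectL`.
-- v4 (D24-23/D25-1): S23″ ↦ S23‴ `stub_windowDefectH` + W7 `stub_highLabelDecay_IS`; IW ↦ IW_H `stub_oneLevelL_IWH`, discharged by the inline glue `GlueH.oneLevelL_IWH_of_piecesH`.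

/-- **S0′ (M+) window propagator** — TEXT BYTE-UNCHANGED from rev5 (discharged by `LagrangianStep.windowPropagatorL`, p648539).  For an `L`-permissible
regular carrier, every level `m` and every coercive constant tensor, the two-parameter solution family of the level-`m` linear problem exists as
contractions of `V2` with the `IsPropagator` properties. -/
theorem stub_windowPropagatorL : ∀ k (E : LatticeShear.LagrangianLatticeCarrier k), E.LPermissible → E.Regular →
    ∀ (m : ℕ) (𝔸 : Torus.Visc4 (Fin 3)) (lo hi : ℝ), 0 < lo → Torus.NearIso 𝔸 lo hi →
      ∃ U : ℝ → ℝ → (V2 →L[ℝ] V2), Torus.IsPropagator 1 (E.partialSum m) 𝔸 U :=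
  windowPropagatorL  -- DISCHARGED (p648539)

/-! ### v9 (lead g3's candidate 814f50d9963133d4, REGISTERED by planner ad-ideate-p1 g25): `stub_windowFactsH` DISCHARGED by the landed final assembly `windowFactsH_of_inputs` (…WindowFactsHAssembly,
p672353) from TWO new registered stubs — W3-E `stub_effectiveFrameEnergyL` (L; holder ad-k3l-bookkeeping-p1; split v28 §4c text VERBATIM) and the
cell-side operator inputs `stub_cellInputs` (XL−; W4/W5/W6/(X_G⁺)/(M♭_G); split v28 §9 text VERBATIM).  Open registered stubs after v9: cellLawV0_IS,
effectiveFrameEnergyL, cellInputs, compactRange, largeR (classReduction discharged v8) — 5 ≤ stubs_max. -/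

/-- **W3-E clause (ii) `stub_effectiveFrameEnergyL_bandKill` — registered v13–v22 text (signature VERBATIM, the two inline comments removed), now a THEOREM (v23, RULING D27-5) := `LagrangianStep.stub_effectiveFrameEnergyL_bandKill` (prover ad-k3l-bookkeeping-p1 g8, p704419: (H) analytic tower, (I) cube tail, (J) small-L floor + capture / ladder F2′–F2c′ / large-L multi-rung).**  (History: NEW REGISTERED STUB v13; holder ad-k3l-bookkeeping-p1 g7/g8.)  The v31 binders of
`stub_effectiveFrameEnergyL` VERBATIM and, as conclusion, its (ii-out) ∧ (ii-in) conjuncts byte-for-byte: the band kill of the window propagator `T ∈ {Um s s', (Um s s')†}`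
in engine-A currency (one factor-2 climb costs `e^(−c₃/θ(m+1))`, additive-hop branch `e^(−(L−L')/(C₂ N_m))`).  Plan (k3l g6 → g7): thin-band LADDER with cube
cut-offs, per-rung leakage via the physical-space commutator `[χ(D), b]∂` (first reprc-moment), iterated time-ordered integral `(Cθ J)^J/J! ≤ e^{−J}`, duality for `T†`. -/
theorem stub_effectiveFrameEnergyL_bandKill : ∀ k (W : Literature.Analysis.FluidPDE.LatticeShear.LatticeWord k) (M : ℝ) (hM : 0 < M) (c : ℝ), 0 < c →
    ∀ (Φ : ℝ → Torus.Visc4 (Fin 3) → Torus.Visc4 (Fin 3)) (lo hi β : ℝ), 0 < lo → lo ≤ 1 → 1 ≤ hi → 0 ≤ β →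
      ∃ C₂ : ℝ, 1 ≤ C₂ ∧ ∃ θ₁ > (0:ℝ), ∃ c₃ > (0:ℝ),
        ∀ E : Literature.Analysis.FluidPDE.LatticeShear.LagrangianLatticeCarrier k, E.design = W.stretch M hM → E.gain = c →
          E.LPermissible → E.Regular → (∀ i, E.θ (i + 1) ≤ θ₁) → (∀ m, E.N m ^ 2 ≤ E.N (m + 1)) →
        ∀ (m : ℕ),
        ∀ (S : Torus.Visc4 (Fin 3)), Torus.OddSmall S β → Torus.NearIso S lo hi →
          Torus.OddSmall (Φ (E.cellVisc (m + 1)) S) β → Torus.NearIso (Φ (E.cellVisc (m + 1)) S) lo hi →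
        ∀ Um : ℝ → ℝ → (V2 →L[ℝ] V2),
          Torus.IsPropagator 1 (E.partialSum m) (E.kbar m • renormStep (Φ (E.cellVisc (m + 1))) (E.gain / E.cellVisc (m + 1) ^ 2) S) Um →
        ∀ (s s' : ℝ), 0 ≤ s → s ≤ s' → s' ≤ 1 → s' - s ≤ 2 * E.refresh (m + 1) →
        ∀ T : V2 →L[ℝ] V2, (T = Um s s' ∨ T = ContinuousLinearMap.adjoint (Um s s')) →
          (∀ L' L : ℕ, 2 * L' ≤ L → ∀ y : V2,
              ‖T y - cutLp L (T y)‖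
                ≤ Real.exp (-(E.a (m + 1) * (8 * Real.pi ^ 2 * (L' : ℝ) ^ 2 * lo * (E.cellVisc (m + 1) + c / E.cellVisc (m + 1))
                    / (E.N (m + 1) : ℝ) ^ 2) * (s' - s) / 2)) * ‖y - cutLp L' y‖
                  + (Real.exp (-(c₃ / E.θ (m + 1))) + Real.exp (-(((L : ℝ) - L') / (C₂ * E.N m)))) * ‖y‖) ∧
          (∀ L' L : ℕ, 2 * L' ≤ L → ∀ y : V2, cutLp L y = 0 →
              ‖T y‖
                ≤ (Real.exp (-(E.a (m + 1) * (8 * Real.pi ^ 2 * (L' : ℝ) ^ 2 * lo * (E.cellVisc (m + 1) + c / E.cellVisc (m + 1))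
                    / (E.N (m + 1) : ℝ) ^ 2) * (s' - s) / 2))
                  + (Real.exp (-(c₃ / E.θ (m + 1))) + Real.exp (-(((L : ℝ) - L') / (C₂ * E.N m))))) * ‖y‖) :=
  Summit.AnomalousDissipation.AnomalousDissipation.Theorems.SolenoidalFractalHomogenisation.LagrangianStep.stub_effectiveFrameEnergyL_bandKill  -- DISCHARGED BY NAME (p704419, k3l g8; D27-5)

/-- **W3-E `stub_effectiveFrameEnergyL` — the §4c v31 text VERBATIM, now a THEOREM (v13):** clause (i) by the landed `effectiveFrameEnergyL_dissipation` (p681732),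
clause (ii) by the registered stub `stub_effectiveFrameEnergyL_bandKill`; `θ₁ := min` of the two strain ceilings. -/
theorem stub_effectiveFrameEnergyL : ∀ k (W : Literature.Analysis.FluidPDE.LatticeShear.LatticeWord k) (M : ℝ) (hM : 0 < M) (c : ℝ), 0 < c →
    ∀ (Φ : ℝ → Torus.Visc4 (Fin 3) → Torus.Visc4 (Fin 3)) (lo hi β : ℝ), 0 < lo → lo ≤ 1 → 1 ≤ hi → 0 ≤ β →
      ∃ C₂ : ℝ, 1 ≤ C₂ ∧ ∃ θ₁ > (0:ℝ), ∃ c₃ > (0:ℝ),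
        ∀ E : Literature.Analysis.FluidPDE.LatticeShear.LagrangianLatticeCarrier k, E.design = W.stretch M hM → E.gain = c →
          E.LPermissible → E.Regular → (∀ i, E.θ (i + 1) ≤ θ₁) → (∀ m, E.N m ^ 2 ≤ E.N (m + 1)) →
        ∀ (m : ℕ),
        ∀ (S : Torus.Visc4 (Fin 3)), Torus.OddSmall S β → Torus.NearIso S lo hi →
          Torus.OddSmall (Φ (E.cellVisc (m + 1)) S) β → Torus.NearIso (Φ (E.cellVisc (m + 1)) S) lo hi →
        ∀ Um : ℝ → ℝ → (V2 →L[ℝ] V2),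
          Torus.IsPropagator 1 (E.partialSum m) (E.kbar m • renormStep (Φ (E.cellVisc (m + 1))) (E.gain / E.cellVisc (m + 1) ^ 2) S) Um →
        ∀ (s s' : ℝ), 0 ≤ s → s ≤ s' → s' ≤ 1 → s' - s ≤ 2 * E.refresh (m + 1) →
        ∀ T : V2 →L[ℝ] V2, (T = Um s s' ∨ T = ContinuousLinearMap.adjoint (Um s s')) →
          -- (i) dissipation floor: the surviving energy loses at least half of the dissipation-weighted spectrum
          (∀ y : V2, ‖T y‖ ^ 2 ≤ ‖y‖ ^ 2 - 1 / 2 * ∑' k' : Fin 3 → ℤ,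
              min 1 (E.a (m + 1) * (8 * Real.pi ^ 2 * ‖Torus.latticeVec k'‖ ^ 2 * lo * (E.cellVisc (m + 1) + c / E.cellVisc (m + 1))
                / (E.N (m + 1) : ℝ) ^ 2) * (s' - s))
              * ‖UnitAddTorus.mFourierCoeff (EuclideanSpace.complexify ∘ ⇑y) k'‖ ^ 2) ∧
          -- (ii-out) band kill, output form (NORM form, factor gap), ENGINE-A currency: one factor-2 climb costs `e^(−c₃/θ(m+1))` (thin geometric
          -- bands, p4 21:08:07Z) and the additive-hop branch `e^(−(L−L')/(C₂ N_m))`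
          (∀ L' L : ℕ, 2 * L' ≤ L → ∀ y : V2,
              ‖T y - cutLp L (T y)‖
                ≤ Real.exp (-(E.a (m + 1) * (8 * Real.pi ^ 2 * (L' : ℝ) ^ 2 * lo * (E.cellVisc (m + 1) + c / E.cellVisc (m + 1))
                    / (E.N (m + 1) : ℝ) ^ 2) * (s' - s) / 2)) * ‖y - cutLp L' y‖
                  + (Real.exp (-(c₃ / E.θ (m + 1))) + Real.exp (-(((L : ℝ) - L') / (C₂ * E.N m)))) * ‖y‖) ∧
          -- (ii-in) band kill, input form (NORM form, factor gap), engine-A currency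
          (∀ L' L : ℕ, 2 * L' ≤ L → ∀ y : V2, cutLp L y = 0 →
              ‖T y‖
                ≤ (Real.exp (-(E.a (m + 1) * (8 * Real.pi ^ 2 * (L' : ℝ) ^ 2 * lo * (E.cellVisc (m + 1) + c / E.cellVisc (m + 1))
                    / (E.N (m + 1) : ℝ) ^ 2) * (s' - s) / 2))
                  + (Real.exp (-(c₃ / E.θ (m + 1))) + Real.exp (-(((L : ℝ) - L') / (C₂ * E.N m))))) * ‖y‖) := by
  intro k W M hM c hc Φ lo hi β hlo hlo1 hhi hβ
  obtain ⟨θa, hθa, hA⟩ := effectiveFrameEnergyL_dissipation k W M hM c hc Φ lo hi β hlo hlo1 hhi hβ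
  obtain ⟨C₂, hC₂, θb, hθb, c₃, hc₃, hB⟩ := stub_effectiveFrameEnergyL_bandKill k W M hM c hc Φ lo hi β hlo hlo1 hhi hβ
  refine ⟨C₂, hC₂, min θa θb, lt_min hθa hθb, c₃, hc₃, ?_⟩
  intro E hdes hgain hLP hReg hθ hsq m S hS₁ hS₂ hS₃ hS₄ Um hUm s s' hs hss' hs'1 hlen T hT
  exact ⟨hA E hdes hgain hLP hReg (fun i => (hθ i).trans (min_le_left _ _)) hsq m S hS₁ hS₂ hS₃ hS₄ Um hUm s s' hs hss' hs'1 hlen T hT,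
    hB E hdes hgain hLP hReg (fun i => (hθ i).trans (min_le_right _ _)) hsq m S hS₁ hS₂ hS₃ hS₄ Um hUm s s' hs hss' hs'1 hlen T hT⟩

/-- **STUB (V ⇒ V_modECW) `stub_Vmod_of_VR` (v23 RE-CUT of v19's `stub_Vmod_of_V`, RULING D27-4/D27-4′ = hypothesis (H1R) of the §9z glue v3 core
`Z7Glue.cellInputs_BIL_ofP` VERBATIM; findings F-p1g14-1, F-p1g14-2, F-p1g14-4; prover ad-sawtooth-k1loc-p1 g14 memo v19 `K1loc-memo-v19-Vmod-cut-k1locp1g14.md` ca0c27bbca185572,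
certifier planner ad-ideate-p5 g14 P1a/P1b CONFIRMED + 3-probe PASS 2026-08-29T06:44Z).**  From the slow-vector cell clause (V) (`SlowVectorClauseF`) — under the
§9z text's own guards plus `ν₀ ≤ 1` — to the MODULATED clause WITH Φ-IMAGE BINDERS `CellClauseMod.SlowVectorClauseModECW` (= `SlowVectorClauseModEC` p692853 +
`Torus.OddSmall (Φ ν ((1/ν)•𝔸)) β →` `(∃ lam ∈ Icc 1 Λ, Torus.NearIso (Φ ν ((1/ν)•𝔸)) (lo/lam) (hi·lam)) →` after the 𝔸-window binder; `…CellClauseModWDefs` p704130)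
at the CAPPED EXPONENT `min (σ/2) (1/2)` (v24 token, RULING D27-6 on certifier finding F-p5g14-1: from (V)(σ) the (ℓ2) block architecture derives exactly `min (σ/2) (1/2)` — the (ss) block needs σ ≥ 2σ′; v23 had `min σ (1/2)`, identical at the V0 lane's σ = 1, un-derivable for σ < 1; the v24 text is WEAKER ⇒ superseded-by-weaker; certifier FINAL stamp 07:29Z): some `θ₁ > 0`, `ϱ₁ > 0` and own constant `Cm ≥ C` (certificate of record: p5 memo v6 `onelevel-L11-Vmod-certifier-critique.md`
6084125eb62e — c_leak = 0.1115, c_mem = 0.230, tent sup ≈ 22, docstring floor Cm ≥ 50; envelope adequate for σ′ ≤ ½).  SUPERSEDED (not refuted, but OVER-STRONG as typed —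
erratum D27-4 (5)): the v19–v22 text `stub_Vmod_of_V : ∀ k W M hM c, 0 < c → ∀ Φ lo hi Λ β σ C ν₀ K, SlowVectorClauseF … σ C ν₀ K → ∃ θ₁ > 0, ∃ ϱ₁ > 0, ∃ Cm, C ≤ Cm ∧
CellClauseMod.SlowVectorClauseModEC … σ Cm ν₀ K θ₁ ϱ₁` is unprovable at any σ > ½ (ν-free sideband→slow leak law η ≥ c_leak (P/τ)^{1/2}, F-p1g14-1) and lacks the Φ-image
coercivity binders (planar zero-gain witness, F-p1g14-2); `VmodCut.VR_of_V : old → new` is proved (companion `VmodCut-k1locp1g14.lean` 216219343e498172), so nothing provable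
was lost.  Scope flag (Q1, D27-4 T2 = (ii) STAGED): the clause still ranges over abstract `IsModulation G`; narrowing to frame-born triples rides a later superseded-by-weaker
event when (ℓ3) is typed.  Owner: prover ad-sawtooth-k1loc-p1 g14 (lane: (ℓ2) `lossFlatW_of_V` flat stage = LINE target D27-4 T3, (ℓ3) modulated stage; w1 sideband engine;
certifier p5).  Why it might fail: a modulated frame could pump the slow vector at a rate not controlled by the coarse losses on sub-slot windows beyond the capped envelope. -/
theorem stub_Vmod_of_VR : ∀ k (W : Literature.Analysis.FluidPDE.LatticeShear.LatticeWord k) (M : ℝ) (hM : 0 < M) (c : ℝ), 0 < c →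
      ∀ (Φ : ℝ → Torus.Visc4 (Fin 3) → Torus.Visc4 (Fin 3)) (lo hi Λ β σ C ν₀ K : ℝ),
        0 < lo → lo ≤ 1 → 1 ≤ hi → 1 < Λ → 0 ≤ β → 0 < σ → 0 ≤ C → 0 < ν₀ → ν₀ ≤ 1 → 0 < K →
        SlowVectorClauseF W M hM c Φ lo hi Λ β σ C ν₀ K →
        ∃ θ₁ > (0:ℝ), ∃ ϱ₁ > (0:ℝ), ∃ Cm : ℝ, C ≤ Cm ∧
          CellClauseMod.SlowVectorClauseModECW W M hM c Φ lo hi Λ β (min (σ / 2) (1 / 2)) Cm ν₀ K θ₁ ϱ₁ := by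
  sorry

/-- **Z7-αβ `stub_Z7_alphaBetaR` — registered v23/v24 text, now a THEOREM (v25) := `Z7Glue.Z7_alphaBetaR_of_hcurv FrameForm.abs_partialDeriv_frameG_le` (assembly `Z7Glue.Z7_alphaBetaR_of_hcurv` p707880, prover ad-k1loc-p3 g9: (α₁)(α₂) via `frameConjugacyAt_of_modulation` p706082 (lead-k1l g5) ∘ `isModulation_frameG_closed` p704979, (N1′)(N1*′) via `N1R_window` p706596 + ad-lit R4′ `IsPropagator.loss_le_enstrophy` p706222/p706469, (N2) via ad-lit S7 `LevelRegular.loss_window_le` p705946 + `CoarseSmoothCarrier` p705295; K8-5 HCURV `FrameForm.abs_partialDeriv_frameG_le` p707845 + `…FrameSecondGradient` p707368, prover lead-k1l-onelevel-p1 g6, road of k3l g8; RULINGS D27-7, D27-8″) (v23 RE-CUT of v19's `stub_Z7_alphaBeta`, RULING D27-4/D27-4′; BY NAME = `Z7Glue.cellInputs_alphaBeta_textR`, `…Z7GlueDefsR` p704133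
= `cellInputs_alphaBeta_text` (p694968) VERBATIM except that (N1)/(N1*) carry the solenoidal guard `Torus.IsWeaklyDivFree (⇑x : VF) →` (resp. `⇑y`) — byte-exact lines
prover ad-k1loc-p3 g9 `N1-lines-textR-k1locp3g9.txt` 57eed6770ee3253e; certifier p5 g14 3-probe PASS 06:44Z/06:48Z).**  Per grid window `[jR, s′]`: (α₁) `FrameConjugacyAt` on
`[jR, (j+1)R]`, (α₂) on `[(j+1)R, s′]` when `(j+1)R < s′`, (N1′)(N1*′) the two full-window N-conversions FOR SOLENOIDAL DATA, (N2) loss-rate monotonicity of the coarse flow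
across `r₁` with constant `Cmono`.  SUPERSEDED (OVER-STRONG as typed — erratum D27-4 (5), finding F-p3g9-2, memo `N1-MEMO-k1locp3g9.md` cb010a7e06f69085): the unguarded
v19–v22 conjuncts (N1)/(N1*) are unprovable — witness `x := ∇cos(2π k′·z)`, `‖k′‖ = 1`: `x ⊥` weakly-div-free ⇒ `Um (jR) s′ x = 0` (`IsPropagator.eq_zero_of_orth`) ⇒
`lossFwd = ‖x‖²` while `X2(x) = min 1 (rate₁ τ)‖x‖²` with `rate_k = 8π²‖k‖² lo kbar m` and `kbar m·R(m+1) → 0` along the cascade; `Z7Glue.alphaBeta_textR_of_text : text → textR`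
(drop the guard) keeps the old line formally stronger, so nothing provable was lost.  The glue core consumes the PRE-PROJECTED form `Z7Glue.cellInputs_alphaBeta_textP`
(datum `(Torus.divFreeL2 (Fin 3)).starProjection x`, X2 of the original x; lines ec0126feeef72fec) through the bridge `Z7Glue.alphaBeta_textP_of_textR : textR → textP`
(`LagrangianStep.nsq_starProjection_le`).  Owners: α-part lead-k1l-onelevel-p1 g5 ((T1) clamped-curve chain (C1)–(C6) landed/submitted; (R1)–(R3) ⇒ `frameConjugacyAt_of_clamped`);
(N1′)/(N1*′) prover ad-k1loc-p3 g9 ((A) `…N1Assembly` p703836 + (P) = ad-lit R4′ `lossFwd_le_gradNormSq`); (N2) literature-prover ad-lit g29 (S1–S6 Galerkin package).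
Why it might fail: the sharp curvature bound `Lip_y DX_m ≤ C♯·N_m·strain m` (needed for `IsModulation.grad_le` with nC ≤ ϱ·N m) could be false for the abstract carrier class. -/
theorem stub_Z7_alphaBetaR : Z7Glue.cellInputs_alphaBeta_textR :=
  Z7Glue.Z7_alphaBetaR_of_hcurv FrameForm.abs_partialDeriv_frameG_le  -- DISCHARGED BY NAME (v25)


open scoped Classical in
/-- **§9d (Recin) `stub_cellInputs_transfer` — registered v19 text (= hypothesis `h9d` of `cellInputs_of_bilinear` p680253 VERBATIM), now a THEOREM (v20) :=
`cellInputs_transfer_of_bilinear_bandKill (Z7Glue.cellInputs_BIL_of stub_Vmod_of_V stub_Z7_alphaBeta) stub_effectiveFrameEnergyL` (p699453, p3 g8 #17; lead memo L14; D26-16).  (History: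
previously the (Recin) half of `stub_cellInputs`).**  The 3×3 high-label transfer bounds of the TRUE window map (W4/W5/W6/(M♭_G)) on every grid
window, with the label classes `B`, `C` chosen per level.  UNOWNED (derivation brief ≥ 10 lines owed by lead g5: which landed W4/(H) facts give
which of the six bounds).  Why it might fail: the `1/2`-contraction of the `C`-class (labels beyond `Lc`) needs the window to be long against the
class's dissipation time uniformly in the carrier — the `refresh ≥ ρ^{1/16}·physPeriod` binder is designed for exactly that. -/
theorem stub_cellInputs_transfer : ∀ k (W : Literature.Analysis.FluidPDE.LatticeShear.LatticeWord k) (M : ℝ) (hM : 0 < M) (c : ℝ), 0 < c →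
    ∀ (Φ : ℝ → Torus.Visc4 (Fin 3) → Torus.Visc4 (Fin 3)) (lo hi Λ β σ C ν₀ K Cf νf Kf : ℝ),
    0 < lo → lo ≤ 1 → 1 ≤ hi → 1 < Λ → 0 ≤ β →
    0 < σ → 0 ≤ C → 0 < ν₀ → 0 < K → SlowVectorClauseF W M hM c Φ lo hi Λ β σ C ν₀ K →
    0 ≤ Cf → 0 < νf → 0 < Kf → CellEnergyClausesW W M hM c lo hi Λ β Cf νf Kf →
    (∀ Kb : ℝ, 1 ≤ Kb → ∃ CK : ℝ, 1 ≤ CK ∧ ∃ cK > (0:ℝ), ∃ νh > (0:ℝ), HighLabelDecayW W M hM lo hi Λ β νh Kb CK cK) →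
    ∃ ν₁ > (0:ℝ), ∃ K₁ > (0:ℝ), ∃ Λ₀ : ℕ, ∃ θ₀ > (0:ℝ), ∃ Cz > (0:ℝ), ∃ σz > (0:ℝ),
    ∀ E : Literature.Analysis.FluidPDE.LatticeShear.LagrangianLatticeCarrier k, E.design = W.stretch M hM → E.gain = c → E.nu0 ≤ ν₁ → K₁ ≤ E.K →
    E.LPermissible → E.Regular → (∀ m, Λ₀ * E.N m ≤ E.N (m + 1)) → (∀ m, E.N m ^ 2 ≤ E.N (m + 1)) →
    (∀ m, E.cellVisc (m + 1) * ((E.N (m + 1) : ℝ) / E.N m) ^ (1 / 4 : ℝ) ≤ 1) →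
    (∀ m, E.K * ((E.N (m + 1) : ℝ) / E.N m) ^ (1 / 4 : ℝ) ≤ ((E.N (m + 1) : ℝ) / E.N m) * E.cellVisc (m + 1)) →
    (∀ m, E.θ (m + 1) * ((E.N (m + 1) : ℝ) / E.N m) ^ (1 / 16 : ℝ) ≤ θ₀) →
    (∀ m, ((E.N (m + 1) : ℝ) / E.N m) ^ (1 / 16 : ℝ) * E.physPeriod (m + 1) ≤ E.refresh (m + 1)) →
    ∃ mstar : ℕ, ∀ m, mstar ≤ m →
    ∀ Lc : ℕ, Lc = ⌊((E.N m : ℝ) / E.N (m + 1)) ^ (1 / 64 : ℝ) * (E.N (m + 1) * E.cellVisc (m + 1)) / Real.sqrt c⌋₊ →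
    ∀ S : Torus.Visc4 (Fin 3), Torus.OddSmall S β → Torus.NearIso S lo hi →
    Torus.OddSmall (Φ (E.cellVisc (m + 1)) S) β → Torus.NearIso (Φ (E.cellVisc (m + 1)) S) lo hi →
    ∀ Um Um1 : ℝ → ℝ → (V2 →L[ℝ] V2),
    Torus.IsPropagator 1 (E.partialSum m) (E.kbar m • renormStep (Φ (E.cellVisc (m + 1))) (E.gain / E.cellVisc (m + 1) ^ 2) S) Um →
    Torus.IsPropagator 1 (E.partialSum (m + 1)) (E.kbar (m + 1) • S) Um1 →
    ∀ ηz ε : ℝ, ηz = Cz * ((E.N m : ℝ) / E.N (m + 1)) ^ σz →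
    ε = ((E.N m : ℝ) / E.N (m + 1)) ^ σz * (1 - Real.exp (-(4 * Real.pi ^ 2 * (E.kbar m * lo)))) * E.refresh (m + 1) →
    ∀ A : Set (Fin 3 → ℤ), A = {k' : Fin 3 → ℤ | ∃ z : Fin 3 → ℤ, Torus.freqNormSq (k' - (E.N (m + 1) : ℤ) • z) ≤ (((Lc / 2 : ℕ) : ℝ)) ^ 2} →
    ∃ B C : Set (Fin 3 → ℤ),
    (∀ k', k' ∈ B ↔ -k' ∈ B) ∧ (∀ k', k' ∈ C ↔ -k' ∈ C) ∧
    (∀ k', k' ∈ A → k' ∉ B) ∧ (∀ k', k' ∈ A → k' ∉ C) ∧ (∀ k', k' ∈ B → k' ∉ C) ∧ (∀ k', k' ∈ A ∨ k' ∈ B ∨ k' ∈ C) ∧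
    (∀ k', k' ∈ C → ((Lc : ℝ)) ^ 2 < Torus.freqNormSq k') ∧
    ∀ P Q₁ Q₂ : V2 →L[ℝ] V2,
    (∀ (y : V2) (k' : Fin 3 → ℤ), UnitAddTorus.mFourierCoeff (EuclideanSpace.complexify ∘ ⇑(P y)) k' = if k' ∈ A then UnitAddTorus.mFourierCoeff (EuclideanSpace.complexify ∘ ⇑(y)) k' else 0) →
    (∀ (y : V2) (k' : Fin 3 → ℤ), UnitAddTorus.mFourierCoeff (EuclideanSpace.complexify ∘ ⇑(Q₁ y)) k' = if k' ∈ B then UnitAddTorus.mFourierCoeff (EuclideanSpace.complexify ∘ ⇑(y)) k' else 0) →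
    (∀ (y : V2) (k' : Fin 3 → ℤ), UnitAddTorus.mFourierCoeff (EuclideanSpace.complexify ∘ ⇑(Q₂ y)) k' = if k' ∈ C then UnitAddTorus.mFourierCoeff (EuclideanSpace.complexify ∘ ⇑(y)) k' else 0) →
    ∀ (w₁ : VF) (hw₁ : IsDatum w₁), Torus.fourierTruncate Lc w₁ = w₁ →
    ∀ (j : ℕ) (s' : ℝ), (j : ℝ) * E.refresh (m + 1) + E.refresh (m + 1) ≤ s' →
    s' ≤ (j : ℝ) * E.refresh (m + 1) + 2 * E.refresh (m + 1) → s' ≤ 1 →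
    ‖Q₁ (Um1 ((j : ℝ) * E.refresh (m + 1)) s' (P (Um1 0 ((j : ℝ) * E.refresh (m + 1)) (datumLp w₁ hw₁))))‖ ≤ Real.sqrt (ηz * (‖Um1 0 ((j : ℝ) * E.refresh (m + 1)) (datumLp w₁ hw₁)‖ ^ 2 - ‖Um ((j : ℝ) * E.refresh (m + 1)) s' (Um1 0 ((j : ℝ) * E.refresh (m + 1)) (datumLp w₁ hw₁))‖ ^ 2)) + ε * ‖datumLp w₁ hw₁‖ ∧
    ‖Q₂ (Um1 ((j : ℝ) * E.refresh (m + 1)) s' (P (Um1 0 ((j : ℝ) * E.refresh (m + 1)) (datumLp w₁ hw₁))))‖ ≤ Real.sqrt (ηz * (‖Um1 0 ((j : ℝ) * E.refresh (m + 1)) (datumLp w₁ hw₁)‖ ^ 2 - ‖Um ((j : ℝ) * E.refresh (m + 1)) s' (Um1 0 ((j : ℝ) * E.refresh (m + 1)) (datumLp w₁ hw₁))‖ ^ 2)) + ε * ‖datumLp w₁ hw₁‖ ∧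
    ‖Q₁ (Um1 ((j : ℝ) * E.refresh (m + 1)) s' (Q₁ (Um1 0 ((j : ℝ) * E.refresh (m + 1)) (datumLp w₁ hw₁))))‖ ≤ ηz * ‖Q₁ (Um1 0 ((j : ℝ) * E.refresh (m + 1)) (datumLp w₁ hw₁))‖ + ε * ‖datumLp w₁ hw₁‖ ∧
    ‖Q₂ (Um1 ((j : ℝ) * E.refresh (m + 1)) s' (Q₁ (Um1 0 ((j : ℝ) * E.refresh (m + 1)) (datumLp w₁ hw₁))))‖ ≤ ηz * ‖Q₁ (Um1 0 ((j : ℝ) * E.refresh (m + 1)) (datumLp w₁ hw₁))‖ + ε * ‖datumLp w₁ hw₁‖ ∧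
    ‖Q₁ (Um1 ((j : ℝ) * E.refresh (m + 1)) s' (Q₂ (Um1 0 ((j : ℝ) * E.refresh (m + 1)) (datumLp w₁ hw₁))))‖ ≤ ηz * ‖Q₂ (Um1 0 ((j : ℝ) * E.refresh (m + 1)) (datumLp w₁ hw₁))‖ + ε * ‖datumLp w₁ hw₁‖ ∧
    ‖Q₂ (Um1 ((j : ℝ) * E.refresh (m + 1)) s' (Q₂ (Um1 0 ((j : ℝ) * E.refresh (m + 1)) (datumLp w₁ hw₁))))‖ ≤ 1 / 2 * ‖Q₂ (Um1 0 ((j : ℝ) * E.refresh (m + 1)) (datumLp w₁ hw₁))‖ + ε * ‖datumLp w₁ hw₁‖ :=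
  cellInputs_transfer_of_bilinear_bandKill (Z7Glue.cellInputs_BIL_ofE (fun σ => min (σ / 2) (1 / 2)) (fun _ hσ => lt_min (half_pos hσ) one_half_pos) stub_Vmod_of_VR (Z7Glue.alphaBeta_textP_of_textR stub_Z7_alphaBetaR)) stub_effectiveFrameEnergyL

open scoped Classical in
/-- **`stub_cellInputs` — the registered v9/v11 text VERBATIM, now a THEOREM (v19) := `cellInputs_of_bilinear (Z7Glue.cellInputs_BIL_of stub_Vmod_of_V stub_Z7_alphaBeta) stub_cellInputs_transfer`
(landed glue p696796 lead g5 + p680253 lead g4).  (History: XL−; W4/W5/W6/(X_G⁺)/(M♭_G) jointly; lead g3 text, split v28 §9 verbatim.)**  The CELL-SIDE OPERATOR INPUTS of the window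
facts: the provider picks a symmetric partition `A, B, C` of `ℤ³` (intended: label distance `≤ Lc/2`, `(Lc/2, Lg]`, `> Lg`) with
`B ∪ C ⊆ {|k|² > (Lc/2)²}`, `C ⊆ {|k|² > Lc²}`, and for the label projectors characterised by them delivers per grid window (Zin) the four
`z_of_pieces` pieces of the low-label window error `P(Uu − Tu)` on the slow-low set `freqBall (Lc/2) ∖ {0}` with weights `min(1, rate_k τ)` at one
small scale `ηz = Cz ρ^σz`, and (Recin) the six transfer bounds. -/
theorem stub_cellInputs : ∀ k (W : Literature.Analysis.FluidPDE.LatticeShear.LatticeWord k) (M : ℝ) (hM : 0 < M) (c : ℝ), 0 < c →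
    ∀ (Φ : ℝ → Torus.Visc4 (Fin 3) → Torus.Visc4 (Fin 3)) (lo hi Λ β σ C ν₀ K Cf νf Kf : ℝ),
      0 < lo → lo ≤ 1 → 1 ≤ hi → 1 < Λ → 0 ≤ β →
      0 < σ → 0 ≤ C → 0 < ν₀ → 0 < K → SlowVectorClauseF W M hM c Φ lo hi Λ β σ C ν₀ K →
      0 ≤ Cf → 0 < νf → 0 < Kf → CellEnergyClausesW W M hM c lo hi Λ β Cf νf Kf →
      (∀ Kb : ℝ, 1 ≤ Kb → ∃ CK : ℝ, 1 ≤ CK ∧ ∃ cK > (0:ℝ), ∃ νh > (0:ℝ), HighLabelDecayW W M hM lo hi Λ β νh Kb CK cK) →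
      ∃ ν₁ > (0:ℝ), ∃ K₁ > (0:ℝ), ∃ Λ₀ : ℕ, ∃ θ₀ > (0:ℝ), ∃ Cz > (0:ℝ), ∃ σz > (0:ℝ),
        ∀ E : Literature.Analysis.FluidPDE.LatticeShear.LagrangianLatticeCarrier k, E.design = W.stretch M hM → E.gain = c → E.nu0 ≤ ν₁ → K₁ ≤ E.K →
          E.LPermissible → E.Regular → (∀ m, Λ₀ * E.N m ≤ E.N (m + 1)) → (∀ m, E.N m ^ 2 ≤ E.N (m + 1)) →
          (∀ m, E.cellVisc (m + 1) * ((E.N (m + 1) : ℝ) / E.N m) ^ (1 / 4 : ℝ) ≤ 1) →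
          (∀ m, E.K * ((E.N (m + 1) : ℝ) / E.N m) ^ (1 / 4 : ℝ) ≤ ((E.N (m + 1) : ℝ) / E.N m) * E.cellVisc (m + 1)) →
          (∀ m, E.θ (m + 1) * ((E.N (m + 1) : ℝ) / E.N m) ^ (1 / 16 : ℝ) ≤ θ₀) →
          (∀ m, ((E.N (m + 1) : ℝ) / E.N m) ^ (1 / 16 : ℝ) * E.physPeriod (m + 1) ≤ E.refresh (m + 1)) →
        ∃ mstar : ℕ, ∀ m, mstar ≤ m →
          E.refresh (m + 1) ≤ 1 / 4 ∧
          ∀ Lc : ℕ, Lc = ⌊((E.N m : ℝ) / E.N (m + 1)) ^ (1 / 64 : ℝ) * (E.N (m + 1) * E.cellVisc (m + 1)) / Real.sqrt c⌋₊ →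
          ∀ S : Torus.Visc4 (Fin 3), Torus.OddSmall S β → Torus.NearIso S lo hi →
            Torus.OddSmall (Φ (E.cellVisc (m + 1)) S) β → Torus.NearIso (Φ (E.cellVisc (m + 1)) S) lo hi →
          ∀ Um Um1 : ℝ → ℝ → (V2 →L[ℝ] V2),
            Torus.IsPropagator 1 (E.partialSum m) (E.kbar m • renormStep (Φ (E.cellVisc (m + 1))) (E.gain / E.cellVisc (m + 1) ^ 2) S) Um →
            Torus.IsPropagator 1 (E.partialSum (m + 1)) (E.kbar (m + 1) • S) Um1 →
          ∀ ηz ε : ℝ, ηz = Cz * ((E.N m : ℝ) / E.N (m + 1)) ^ σz →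
            ε = ((E.N m : ℝ) / E.N (m + 1)) ^ σz * (1 - Real.exp (-(4 * Real.pi ^ 2 * (E.kbar m * lo)))) * E.refresh (m + 1) →
          ∃ A B C : Set (Fin 3 → ℤ),
            (∀ k', k' ∈ A ↔ -k' ∈ A) ∧ (∀ k', k' ∈ B ↔ -k' ∈ B) ∧ (∀ k', k' ∈ C ↔ -k' ∈ C) ∧
            (∀ k', k' ∈ A → k' ∉ B) ∧ (∀ k', k' ∈ A → k' ∉ C) ∧ (∀ k', k' ∈ B → k' ∉ C) ∧ (∀ k', k' ∈ A ∨ k' ∈ B ∨ k' ∈ C) ∧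
            (∀ k', k' ∈ B ∨ k' ∈ C → (((Lc / 2 : ℕ) : ℝ)) ^ 2 < Torus.freqNormSq k') ∧ (∀ k', k' ∈ C → ((Lc : ℝ)) ^ 2 < Torus.freqNormSq k') ∧
          ∀ P Q₁ Q₂ : V2 →L[ℝ] V2,
            (∀ (y : V2) (k' : Fin 3 → ℤ), UnitAddTorus.mFourierCoeff (EuclideanSpace.complexify ∘ ⇑(P y)) k' = if k' ∈ A then UnitAddTorus.mFourierCoeff (EuclideanSpace.complexify ∘ ⇑(y)) k' else 0) →
            (∀ (y : V2) (k' : Fin 3 → ℤ), UnitAddTorus.mFourierCoeff (EuclideanSpace.complexify ∘ ⇑(Q₁ y)) k' = if k' ∈ B then UnitAddTorus.mFourierCoeff (EuclideanSpace.complexify ∘ ⇑(y)) k' else 0) →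
            (∀ (y : V2) (k' : Fin 3 → ℤ), UnitAddTorus.mFourierCoeff (EuclideanSpace.complexify ∘ ⇑(Q₂ y)) k' = if k' ∈ C then UnitAddTorus.mFourierCoeff (EuclideanSpace.complexify ∘ ⇑(y)) k' else 0) →
          ∀ (w₁ : VF) (hw₁ : IsDatum w₁), Torus.fourierTruncate Lc w₁ = w₁ →
            ∀ (j : ℕ) (s' : ℝ), (j : ℝ) * E.refresh (m + 1) + E.refresh (m + 1) ≤ s' →
              s' ≤ (j : ℝ) * E.refresh (m + 1) + 2 * E.refresh (m + 1) → s' ≤ 1 →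
              -- (Zin) the low-label window error splits into the four pieces of `z_of_pieces` (diag W6 · cross (X_G⁺) · leak W5 · fast W5⊕(M♭_G))
              (∃ e_d e_c e_l e_f : V2,
                P (Um1 ((j : ℝ) * E.refresh (m + 1)) s' (Um1 0 ((j : ℝ) * E.refresh (m + 1)) (datumLp w₁ hw₁)) - Um ((j : ℝ) * E.refresh (m + 1)) s' (Um1 0 ((j : ℝ) * E.refresh (m + 1)) (datumLp w₁ hw₁))) = e_d + e_c + e_l + e_f ∧
                (∀ k', k' ∉ ((Torus.freqBall (Lc / 2)).erase 0) → UnitAddTorus.mFourierCoeff (EuclideanSpace.complexify ∘ ⇑(e_d)) k' = 0) ∧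
                (∀ k', k' ∉ ((Torus.freqBall (Lc / 2)).erase 0) → UnitAddTorus.mFourierCoeff (EuclideanSpace.complexify ∘ ⇑(e_l)) k' = 0) ∧
                (∀ k', k' ∈ ((Torus.freqBall (Lc / 2)).erase 0) → UnitAddTorus.mFourierCoeff (EuclideanSpace.complexify ∘ ⇑(e_f)) k' = 0) ∧
                (∀ k', k' ∈ ((Torus.freqBall (Lc / 2)).erase 0) →
                  ‖UnitAddTorus.mFourierCoeff (EuclideanSpace.complexify ∘ ⇑(e_d)) k'‖ ≤ ηz * min 1 ((E.a (m + 1) * (8 * Real.pi ^ 2 * ‖Torus.latticeVec k'‖ ^ 2 * lo * (E.cellVisc (m + 1) + c / E.cellVisc (m + 1)) / (E.N (m + 1) : ℝ) ^ 2)) * (s' - (j : ℝ) * E.refresh (m + 1))) * ‖UnitAddTorus.mFourierCoeff (EuclideanSpace.complexify ∘ ⇑(Um1 0 ((j : ℝ) * E.refresh (m + 1)) (datumLp w₁ hw₁))) k'‖) ∧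
                (∀ y : V2, |⟪y, e_c⟫_ℝ| ≤ ηz
                  * Real.sqrt (∑ k' ∈ ((Torus.freqBall (Lc / 2)).erase 0), min 1 ((E.a (m + 1) * (8 * Real.pi ^ 2 * ‖Torus.latticeVec k'‖ ^ 2 * lo * (E.cellVisc (m + 1) + c / E.cellVisc (m + 1)) / (E.N (m + 1) : ℝ) ^ 2)) * (s' - (j : ℝ) * E.refresh (m + 1))) * ‖UnitAddTorus.mFourierCoeff (EuclideanSpace.complexify ∘ ⇑(Um1 0 ((j : ℝ) * E.refresh (m + 1)) (datumLp w₁ hw₁))) k'‖ ^ 2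
                      + (‖Um1 0 ((j : ℝ) * E.refresh (m + 1)) (datumLp w₁ hw₁)‖ ^ 2 - ∑ k' ∈ ((Torus.freqBall (Lc / 2)).erase 0), ‖UnitAddTorus.mFourierCoeff (EuclideanSpace.complexify ∘ ⇑(Um1 0 ((j : ℝ) * E.refresh (m + 1)) (datumLp w₁ hw₁))) k'‖ ^ 2))
                  * Real.sqrt (∑ k' ∈ ((Torus.freqBall (Lc / 2)).erase 0), min 1 ((E.a (m + 1) * (8 * Real.pi ^ 2 * ‖Torus.latticeVec k'‖ ^ 2 * lo * (E.cellVisc (m + 1) + c / E.cellVisc (m + 1)) / (E.N (m + 1) : ℝ) ^ 2)) * (s' - (j : ℝ) * E.refresh (m + 1))) * ‖UnitAddTorus.mFourierCoeff (EuclideanSpace.complexify ∘ ⇑(y)) k'‖ ^ 2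
                      + (‖y‖ ^ 2 - ∑ k' ∈ ((Torus.freqBall (Lc / 2)).erase 0), ‖UnitAddTorus.mFourierCoeff (EuclideanSpace.complexify ∘ ⇑(y)) k'‖ ^ 2))) ∧
                (∑ k' ∈ ((Torus.freqBall (Lc / 2)).erase 0), ‖UnitAddTorus.mFourierCoeff (EuclideanSpace.complexify ∘ ⇑(e_l)) k'‖ ^ 2 / (ηz ^ 2 * min 1 ((E.a (m + 1) * (8 * Real.pi ^ 2 * ‖Torus.latticeVec k'‖ ^ 2 * lo * (E.cellVisc (m + 1) + c / E.cellVisc (m + 1)) / (E.N (m + 1) : ℝ) ^ 2)) * (s' - (j : ℝ) * E.refresh (m + 1))))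
                  ≤ ‖Um1 0 ((j : ℝ) * E.refresh (m + 1)) (datumLp w₁ hw₁)‖ ^ 2 - ∑ k' ∈ ((Torus.freqBall (Lc / 2)).erase 0), ‖UnitAddTorus.mFourierCoeff (EuclideanSpace.complexify ∘ ⇑(Um1 0 ((j : ℝ) * E.refresh (m + 1)) (datumLp w₁ hw₁))) k'‖ ^ 2) ∧
                ‖e_f‖ ≤ Real.sqrt (∑ k' ∈ ((Torus.freqBall (Lc / 2)).erase 0), ηz ^ 2 * min 1 ((E.a (m + 1) * (8 * Real.pi ^ 2 * ‖Torus.latticeVec k'‖ ^ 2 * lo * (E.cellVisc (m + 1) + c / E.cellVisc (m + 1)) / (E.N (m + 1) : ℝ) ^ 2)) * (s' - (j : ℝ) * E.refresh (m + 1))) * ‖UnitAddTorus.mFourierCoeff (EuclideanSpace.complexify ∘ ⇑(Um1 0 ((j : ℝ) * E.refresh (m + 1)) (datumLp w₁ hw₁))) k'‖ ^ 2)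
                  + ηz * Real.sqrt (‖Um1 0 ((j : ℝ) * E.refresh (m + 1)) (datumLp w₁ hw₁)‖ ^ 2 - ∑ k' ∈ ((Torus.freqBall (Lc / 2)).erase 0), ‖UnitAddTorus.mFourierCoeff (EuclideanSpace.complexify ∘ ⇑(Um1 0 ((j : ℝ) * E.refresh (m + 1)) (datumLp w₁ hw₁))) k'‖ ^ 2)) ∧
              -- (Recin) the 3×3 high-label transfer bounds of the true window map (W4/W5/W6/(M♭_G))
              ‖Q₁ (Um1 ((j : ℝ) * E.refresh (m + 1)) s' (P (Um1 0 ((j : ℝ) * E.refresh (m + 1)) (datumLp w₁ hw₁))))‖ ≤ Real.sqrt (ηz * (‖Um1 0 ((j : ℝ) * E.refresh (m + 1)) (datumLp w₁ hw₁)‖ ^ 2 - ‖Um ((j : ℝ) * E.refresh (m + 1)) s' (Um1 0 ((j : ℝ) * E.refresh (m + 1)) (datumLp w₁ hw₁))‖ ^ 2)) + ε * ‖datumLp w₁ hw₁‖ ∧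
              ‖Q₂ (Um1 ((j : ℝ) * E.refresh (m + 1)) s' (P (Um1 0 ((j : ℝ) * E.refresh (m + 1)) (datumLp w₁ hw₁))))‖ ≤ Real.sqrt (ηz * (‖Um1 0 ((j : ℝ) * E.refresh (m + 1)) (datumLp w₁ hw₁)‖ ^ 2 - ‖Um ((j : ℝ) * E.refresh (m + 1)) s' (Um1 0 ((j : ℝ) * E.refresh (m + 1)) (datumLp w₁ hw₁))‖ ^ 2)) + ε * ‖datumLp w₁ hw₁‖ ∧
              ‖Q₁ (Um1 ((j : ℝ) * E.refresh (m + 1)) s' (Q₁ (Um1 0 ((j : ℝ) * E.refresh (m + 1)) (datumLp w₁ hw₁))))‖ ≤ ηz * ‖Q₁ (Um1 0 ((j : ℝ) * E.refresh (m + 1)) (datumLp w₁ hw₁))‖ + ε * ‖datumLp w₁ hw₁‖ ∧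
              ‖Q₂ (Um1 ((j : ℝ) * E.refresh (m + 1)) s' (Q₁ (Um1 0 ((j : ℝ) * E.refresh (m + 1)) (datumLp w₁ hw₁))))‖ ≤ ηz * ‖Q₁ (Um1 0 ((j : ℝ) * E.refresh (m + 1)) (datumLp w₁ hw₁))‖ + ε * ‖datumLp w₁ hw₁‖ ∧
              ‖Q₁ (Um1 ((j : ℝ) * E.refresh (m + 1)) s' (Q₂ (Um1 0 ((j : ℝ) * E.refresh (m + 1)) (datumLp w₁ hw₁))))‖ ≤ ηz * ‖Q₂ (Um1 0 ((j : ℝ) * E.refresh (m + 1)) (datumLp w₁ hw₁))‖ + ε * ‖datumLp w₁ hw₁‖ ∧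
              ‖Q₂ (Um1 ((j : ℝ) * E.refresh (m + 1)) s' (Q₂ (Um1 0 ((j : ℝ) * E.refresh (m + 1)) (datumLp w₁ hw₁))))‖ ≤ 1 / 2 * ‖Q₂ (Um1 0 ((j : ℝ) * E.refresh (m + 1)) (datumLp w₁ hw₁))‖ + ε * ‖datumLp w₁ hw₁‖ :=
  cellInputs_of_bilinear (Z7Glue.cellInputs_BIL_ofE (fun σ => min (σ / 2) (1 / 2)) (fun _ hσ => lt_min (half_pos hσ) one_half_pos) stub_Vmod_of_VR (Z7Glue.alphaBeta_textP_of_textR stub_Z7_alphaBetaR)) stub_cellInputs_transfer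

/-- **`stub_windowFactsH` (XL−; v5 candidate, holder lead-k1l-onelevel-p1) — the WINDOW FACTS in operator form.**  Same prefix as S23‴ (design,
(V) `SlowVectorClauseF`, (F) `CellEnergyClausesW`, the high-label decay family (H) `HighLabelDecayW`); then regime pins `ν₁, K₁`, template constants
`Λ₀, θ₀`, ONE small scale `Cw ρ^σw` and, for every `L`-permissible regular carrier on the template, `m ≥ m⋆(E)`: the refresh window is `≤ 1/4`, and for
every trim level `Lc` below the TrimLevel cap, every window shape `S` (window facts on `S` and `Φ ν S` as hypotheses) and every pair of propagators
`Um` (coarse, renormalised tensor) / `Um1` (true, `kbar(m+1)•S`) there is an orthogonal three-way splitting `P ⊕ Q₁ ⊕ Q₂` of `V2` (INTENDED: Bloch-label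
classes `‖lab‖ ≤ Lc/2`, `(Lc/2, Lg]`, `> Lg`; the construction of these projectors on `L²(𝕋³;ℝ³)` is part of the stub) with `Q₂ x₁ = 0` on data
band-limited at `Lc`, such that on every grid-aligned window `[j r, s']`, `r ≤ s' − j r ≤ 2r` (`r = refresh (m+1)`), with `u := Um1 0 (j r) x₁` the true
chain state, `T := Um (j r) s'`, `U := Um1 (j r) s'`, `𝔇 := ‖u‖² − ‖T u‖²`, `ηm := Cw ρ^σw`, `ε := ρ^σw (1 − e^(−4π² kbar_m lo)) r`:
(Z) `|⟪y, P (U u − T u)⟫| ≤ ηm √𝔇 √(‖y‖² − ‖T† y‖²) + ε ‖x₁‖ ‖y‖` for all `y` — (V_G)/(X_G⁺)/(C_G⁺)/(F_G⁺)/(E_G′) through `dd_assembly_op` + floors,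
    INCLUDING the reset-scrambled corrector deposits of the high-label content (fast ⇒ adjoint-dissipated: still (DD));
(Hi) `‖T (Q y)‖, ‖Q (T y)‖, ‖T† (Q y)‖ ≤ ε ‖y‖`, `Q = Q₁ + Q₂` — (E_G⁺) forward/adjoint + S3e⁺ (coarse flow kills / does not create labels `> Lc/2`);
(Rec) `‖Q_i (U (P u))‖ ≤ √(ηm 𝔇) + ε‖x₁‖` (climbs + deposits, dissipation-weighted), `‖Q_i (U (Q₁ u))‖ ≤ ηm ‖Q₁ u‖ + ε‖x₁‖` (mid labels tracked and
    killed within a window: (V_G) floor at `|ℓ| ≤ Lg` + `D_w(Lc/2) ≫ 1`), `‖Q₁ (U (Q₂ u))‖ ≤ ηm ‖Q₂ u‖ + ε‖x₁‖`, `‖Q₂ (U (Q₂ u))‖ ≤ ½ ‖Q₂ u‖ + ε‖x₁‖`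
    (in-range contraction (B_G^c) ⊕ (M♭_G) from (H) beyond `c_V nν/K`).
WHY THIS CUT: `windowDefectH_of_windowFacts` (…WindowDefectHGlue, sorry-free) proves S23‴ from exactly this text; what remains is cell/frame analysis
(W1–W7 of `Lines/onelevel-briefs.md`) + the label projectors.  Review asks (p4/tenure): truth of (Hi) for the PHYSICAL-coordinate coarse maps (frame
re-reading S3e⁺), the `1/2` in (Rec) at labels near the range top, and the (DD) shape of h-sourced deposits in (Z). -/
theorem stub_windowFactsH : ∀ k (W : Literature.Analysis.FluidPDE.LatticeShear.LatticeWord k) (M : ℝ) (hM : 0 < M) (c : ℝ), 0 < c →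
    ∀ (Φ : ℝ → Torus.Visc4 (Fin 3) → Torus.Visc4 (Fin 3)) (lo hi Λ β σ C ν₀ K Cf νf Kf : ℝ),
      0 < lo → lo ≤ 1 → 1 ≤ hi → 1 < Λ → 0 ≤ β →
      0 < σ → 0 ≤ C → 0 < ν₀ → 0 < K → SlowVectorClauseF W M hM c Φ lo hi Λ β σ C ν₀ K →
      0 ≤ Cf → 0 < νf → 0 < Kf → CellEnergyClausesW W M hM c lo hi Λ β Cf νf Kf →
      (∀ Kb : ℝ, 1 ≤ Kb → ∃ CK : ℝ, 1 ≤ CK ∧ ∃ cK > (0:ℝ), ∃ νh > (0:ℝ), HighLabelDecayW W M hM lo hi Λ β νh Kb CK cK) →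
      ∃ ν₁ > (0:ℝ), ∃ K₁ > (0:ℝ), ∃ Λ₀ : ℕ, ∃ θ₀ > (0:ℝ), ∃ Cw > (0:ℝ), ∃ σw > (0:ℝ),
        ∀ E : Literature.Analysis.FluidPDE.LatticeShear.LagrangianLatticeCarrier k, E.design = W.stretch M hM → E.gain = c → E.nu0 ≤ ν₁ → K₁ ≤ E.K →
          E.LPermissible → E.Regular → (∀ m, Λ₀ * E.N m ≤ E.N (m + 1)) → (∀ m, E.N m ^ 2 ≤ E.N (m + 1)) →
          (∀ m, E.cellVisc (m + 1) * ((E.N (m + 1) : ℝ) / E.N m) ^ (1 / 4 : ℝ) ≤ 1) →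
          (∀ m, E.K * ((E.N (m + 1) : ℝ) / E.N m) ^ (1 / 4 : ℝ) ≤ ((E.N (m + 1) : ℝ) / E.N m) * E.cellVisc (m + 1)) →
          (∀ m, E.θ (m + 1) * ((E.N (m + 1) : ℝ) / E.N m) ^ (1 / 16 : ℝ) ≤ θ₀) →
          (∀ m, ((E.N (m + 1) : ℝ) / E.N m) ^ (1 / 16 : ℝ) * E.physPeriod (m + 1) ≤ E.refresh (m + 1)) →
        ∃ mstar : ℕ, ∀ m, mstar ≤ m →
          E.refresh (m + 1) ≤ 1 / 4 ∧
          ∀ Lc : ℕ, Lc = ⌊((E.N m : ℝ) / E.N (m + 1)) ^ (1 / 64 : ℝ) * (E.N (m + 1) * E.cellVisc (m + 1)) / Real.sqrt c⌋₊ →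
          ∀ S : Torus.Visc4 (Fin 3), Torus.OddSmall S β → Torus.NearIso S lo hi →
            Torus.OddSmall (Φ (E.cellVisc (m + 1)) S) β → Torus.NearIso (Φ (E.cellVisc (m + 1)) S) lo hi →
          ∀ Um Um1 : ℝ → ℝ → (V2 →L[ℝ] V2),
            Torus.IsPropagator 1 (E.partialSum m) (E.kbar m • renormStep (Φ (E.cellVisc (m + 1))) (E.gain / E.cellVisc (m + 1) ^ 2) S) Um →
            Torus.IsPropagator 1 (E.partialSum (m + 1)) (E.kbar (m + 1) • S) Um1 →
          ∀ ηm ε : ℝ, ηm = Cw * ((E.N m : ℝ) / E.N (m + 1)) ^ σw →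
            ε = ((E.N m : ℝ) / E.N (m + 1)) ^ σw * (1 - Real.exp (-(4 * Real.pi ^ 2 * (E.kbar m * lo)))) * E.refresh (m + 1) →
          ∃ P Q₁ Q₂ : V2 →L[ℝ] V2,
            (∀ y : V2, P y + Q₁ y + Q₂ y = y) ∧ (∀ y : V2, ‖y‖ ^ 2 = ‖P y‖ ^ 2 + ‖Q₁ y‖ ^ 2 + ‖Q₂ y‖ ^ 2) ∧
            (∀ y y' : V2, ⟪P y, Q₁ y' + Q₂ y'⟫_ℝ = 0) ∧
          ∀ (w₁ : VF) (hw₁ : IsDatum w₁), Torus.fourierTruncate Lc w₁ = w₁ →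
            Q₂ (datumLp w₁ hw₁) = 0 ∧
            ∀ (j : ℕ) (s' : ℝ), (j : ℝ) * E.refresh (m + 1) + E.refresh (m + 1) ≤ s' →
              s' ≤ (j : ℝ) * E.refresh (m + 1) + 2 * E.refresh (m + 1) → s' ≤ 1 →
            (∀ y : V2, |⟪y, P (Um1 ((j : ℝ) * E.refresh (m + 1)) s' (Um1 0 ((j : ℝ) * E.refresh (m + 1)) (datumLp w₁ hw₁)) - Um ((j : ℝ) * E.refresh (m + 1)) s' (Um1 0 ((j : ℝ) * E.refresh (m + 1)) (datumLp w₁ hw₁)))⟫_ℝ| ≤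
                ηm * Real.sqrt (‖Um1 0 ((j : ℝ) * E.refresh (m + 1)) (datumLp w₁ hw₁)‖ ^ 2 - ‖Um ((j : ℝ) * E.refresh (m + 1)) s' (Um1 0 ((j : ℝ) * E.refresh (m + 1)) (datumLp w₁ hw₁))‖ ^ 2) * Real.sqrt (‖y‖ ^ 2 - ‖ContinuousLinearMap.adjoint (Um ((j : ℝ) * E.refresh (m + 1)) s') y‖ ^ 2) + ε * ‖datumLp w₁ hw₁‖ * ‖y‖) ∧
            (∀ y : V2, ‖Um ((j : ℝ) * E.refresh (m + 1)) s' (Q₁ y + Q₂ y)‖ ≤ ε * ‖y‖ ∧ ‖Q₁ (Um ((j : ℝ) * E.refresh (m + 1)) s' y) + Q₂ (Um ((j : ℝ) * E.refresh (m + 1)) s' y)‖ ≤ ε * ‖y‖ ∧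
                ‖ContinuousLinearMap.adjoint (Um ((j : ℝ) * E.refresh (m + 1)) s') (Q₁ y + Q₂ y)‖ ≤ ε * ‖y‖) ∧
            ‖Q₁ (Um1 ((j : ℝ) * E.refresh (m + 1)) s' (P (Um1 0 ((j : ℝ) * E.refresh (m + 1)) (datumLp w₁ hw₁))))‖ ≤ Real.sqrt (ηm * (‖Um1 0 ((j : ℝ) * E.refresh (m + 1)) (datumLp w₁ hw₁)‖ ^ 2 - ‖Um ((j : ℝ) * E.refresh (m + 1)) s' (Um1 0 ((j : ℝ) * E.refresh (m + 1)) (datumLp w₁ hw₁))‖ ^ 2)) + ε * ‖datumLp w₁ hw₁‖ ∧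
            ‖Q₂ (Um1 ((j : ℝ) * E.refresh (m + 1)) s' (P (Um1 0 ((j : ℝ) * E.refresh (m + 1)) (datumLp w₁ hw₁))))‖ ≤ Real.sqrt (ηm * (‖Um1 0 ((j : ℝ) * E.refresh (m + 1)) (datumLp w₁ hw₁)‖ ^ 2 - ‖Um ((j : ℝ) * E.refresh (m + 1)) s' (Um1 0 ((j : ℝ) * E.refresh (m + 1)) (datumLp w₁ hw₁))‖ ^ 2)) + ε * ‖datumLp w₁ hw₁‖ ∧
            ‖Q₁ (Um1 ((j : ℝ) * E.refresh (m + 1)) s' (Q₁ (Um1 0 ((j : ℝ) * E.refresh (m + 1)) (datumLp w₁ hw₁))))‖ ≤ ηm * ‖Q₁ (Um1 0 ((j : ℝ) * E.refresh (m + 1)) (datumLp w₁ hw₁))‖ + ε * ‖datumLp w₁ hw₁‖ ∧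
            ‖Q₂ (Um1 ((j : ℝ) * E.refresh (m + 1)) s' (Q₁ (Um1 0 ((j : ℝ) * E.refresh (m + 1)) (datumLp w₁ hw₁))))‖ ≤ ηm * ‖Q₁ (Um1 0 ((j : ℝ) * E.refresh (m + 1)) (datumLp w₁ hw₁))‖ + ε * ‖datumLp w₁ hw₁‖ ∧
            ‖Q₁ (Um1 ((j : ℝ) * E.refresh (m + 1)) s' (Q₂ (Um1 0 ((j : ℝ) * E.refresh (m + 1)) (datumLp w₁ hw₁))))‖ ≤ ηm * ‖Q₂ (Um1 0 ((j : ℝ) * E.refresh (m + 1)) (datumLp w₁ hw₁))‖ + ε * ‖datumLp w₁ hw₁‖ ∧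
            ‖Q₂ (Um1 ((j : ℝ) * E.refresh (m + 1)) s' (Q₂ (Um1 0 ((j : ℝ) * E.refresh (m + 1)) (datumLp w₁ hw₁))))‖ ≤ 1 / 2 * ‖Q₂ (Um1 0 ((j : ℝ) * E.refresh (m + 1)) (datumLp w₁ hw₁))‖ + ε * ‖datumLp w₁ hw₁‖ :=
  windowFactsH_of_inputs₃ stub_effectiveFrameEnergyL stub_cellInputs  -- v12: DISCHARGED by the landed V3 assembly (prover ad-k1loc-p3 g7, p679770; §4c v31 = v30 + F-k3l-6 binders (a) `(∀ m, E.N m ^ 2 ≤ E.N (m + 1)) →`, (b) `Torus.OddSmall S β → Torus.NearIso S lo hi →`; tenure D25-13)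


/-- **S23‴ (XL−; holder lead-k1l-onelevel-p1) window defect ⇒ TRIMMED ENERGY COMPARISON, given the high-label decay family (H).**  For `m ≥ m⋆(R,E)`
the stub CHOOSES the trim level `Lc` and exports the trim budget `R ≤ Cτ ρ^στ Lc² (1 − e^{−4π² kbar_m lo})` and `Cη ρ^ση ≤ 1/8`; then for every window shape
`S`, every band-limited class-`R` datum `w₁` (`P_{Lc} w₁ = w₁`) and the two propagators `U⁰ = U^m` (renormalised tensor) and `U¹ = U^{m+1}`:
`‖U¹_{0→t} x₁‖² ≤ ‖U⁰_{0→t} x₁‖² + Cη ρ^ση (‖x₁‖² − ‖U⁰_{0→t} x₁‖²)` for `t ∈ (1/2, 1)`, `x₁ := datumLp w₁`.  Inputs: (V) `SlowVectorClauseF`, (F) `CellEnergyClausesW`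
and (H) as the FAMILY `∀ Kb ≥ 1, ∃ CK ≥ 1, ∃ cK > 0, ∃ νh > 0, HighLabelDecayW W M hM lo hi Λ β νh Kb CK cK` (the stub picks `Kb ≥ K/c_V` and `ν₁ ≤ νh`).
Architecture of record (lead L4c / p4 g12 §6–§8 of `Lines/onelevel_S23_split.lean`): frames + Bloch-fibred cell dynamics per window, in-range contraction from
(V)+(C)(F)(X), high-label contraction from (H), window ledger `window_ledger_split` with the reset-scrambled deposits paid by (H) over the next window.
TEXT OF RECORD: p4 g12 `windowDefectH_textKb` (block sha16 67be95a17dc9ee1d), tenure D25-1. -/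
theorem stub_windowDefectH : ∀ k (W : Literature.Analysis.FluidPDE.LatticeShear.LatticeWord k) (M : ℝ) (hM : 0 < M) (c : ℝ), 0 < c →
    ∀ (Φ : ℝ → Torus.Visc4 (Fin 3) → Torus.Visc4 (Fin 3)) (lo hi Λ β σ C ν₀ K Cf νf Kf : ℝ),
      0 < lo → lo ≤ 1 → 1 ≤ hi → 1 < Λ → 0 ≤ β →
      0 < σ → 0 ≤ C → 0 < ν₀ → 0 < K → SlowVectorClauseF W M hM c Φ lo hi Λ β σ C ν₀ K →
      0 ≤ Cf → 0 < νf → 0 < Kf → CellEnergyClausesW W M hM c lo hi Λ β Cf νf Kf →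
      (∀ Kb : ℝ, 1 ≤ Kb → ∃ CK : ℝ, 1 ≤ CK ∧ ∃ cK > (0:ℝ), ∃ νh > (0:ℝ), HighLabelDecayW W M hM lo hi Λ β νh Kb CK cK) →
      ∃ ν₁ > (0:ℝ), ∃ K₁ > (0:ℝ), ∃ Λ₀ : ℕ, ∃ θ₀ > (0:ℝ), ∃ Cη > (0:ℝ), ∃ ση > (0:ℝ), ∃ Cτ > (0:ℝ), ∃ στ > (0:ℝ),
        ∀ E : Literature.Analysis.FluidPDE.LatticeShear.LagrangianLatticeCarrier k, E.design = W.stretch M hM → E.gain = c → E.nu0 ≤ ν₁ → K₁ ≤ E.K →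
          E.LPermissible → E.Regular → (∀ m, Λ₀ * E.N m ≤ E.N (m + 1)) → (∀ m, E.N m ^ 2 ≤ E.N (m + 1)) →
          (∀ m, E.cellVisc (m + 1) * ((E.N (m + 1) : ℝ) / E.N m) ^ (1 / 4 : ℝ) ≤ 1) →
          (∀ m, E.K * ((E.N (m + 1) : ℝ) / E.N m) ^ (1 / 4 : ℝ) ≤ ((E.N (m + 1) : ℝ) / E.N m) * E.cellVisc (m + 1)) →
          (∀ m, E.θ (m + 1) * ((E.N (m + 1) : ℝ) / E.N m) ^ (1 / 16 : ℝ) ≤ θ₀) →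
          (∀ m, ((E.N (m + 1) : ℝ) / E.N m) ^ (1 / 16 : ℝ) * E.physPeriod (m + 1) ≤ E.refresh (m + 1)) →
        ∀ R : ℝ≥0, ∃ mstar : ℕ, ∀ m, mstar ≤ m →
          ∃ Lc : ℕ,
          (R : ℝ) ≤ Cτ * ((E.N m : ℝ) / E.N (m + 1)) ^ στ * (Lc : ℝ) ^ 2 * (1 - Real.exp (-(4 * Real.pi ^ 2 * (E.kbar m * lo)))) ∧
          Cη * ((E.N m : ℝ) / E.N (m + 1)) ^ ση ≤ 1 / 8 ∧
          ∀ S : Torus.Visc4 (Fin 3), Torus.OddSmall S β → Torus.NearIso S lo hi →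
            Torus.OddSmall (Φ (E.cellVisc (m + 1)) S) β → Torus.NearIso (Φ (E.cellVisc (m + 1)) S) lo hi →
          ∀ (w₁ : VF) (hw₁ : IsDatum w₁), InClass R w₁ → Torus.fourierTruncate Lc w₁ = w₁ →
          ∀ Um Um1 : ℝ → ℝ → (V2 →L[ℝ] V2),
            Torus.IsPropagator 1 (E.partialSum m) (E.kbar m • renormStep (Φ (E.cellVisc (m + 1))) (E.gain / E.cellVisc (m + 1) ^ 2) S) Um →
            Torus.IsPropagator 1 (E.partialSum (m + 1)) (E.kbar (m + 1) • S) Um1 →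
          ∀ t ∈ Ioo (1/2 : ℝ) 1,
            ‖Um1 0 t (datumLp w₁ hw₁)‖ ^ 2
              ≤ ‖Um 0 t (datumLp w₁ hw₁)‖ ^ 2
                + Cη * ((E.N m : ℝ) / E.N (m + 1)) ^ ση * (‖datumLp w₁ hw₁‖ ^ 2 - ‖Um 0 t (datumLp w₁ hw₁)‖ ^ 2) :=
  windowDefectH_of_windowFactsPinned stub_windowFactsH  -- v6′: DISCHARGED by the landed operator-level glue, PINNED trim level (p665050 + amendment p667311, F-lead-10)

/-! ### v5 (tenure D25-4): W7 RE-CUT INTO THREE PIECES (planner ad-ideate-p5 g9 «profile», `Lines/onelevel_highLabelDecay_recut.lean` 789f4cac7563e1d7,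
farm rc 0 with sorries only in the three pieces; reviewed p4 g13 / tenure g25).  `stub_highLabelDecay_IS` (the v4 registered W7 text, UNCHANGED) is now PROVED
in-skeleton from the three registered pieces by p5's kernel-checked composition (`highLabelDecay_IS_of_recut`, inlined below as the proof term), over the LANDED
per-class clause `ClassDecayW` + `admAll` / `admCompact R₁` / `admLarge R₁` + splice `classDecayW_split` (DefsW7).  Pieces:
* `stub_classReduction` (M) — PER-BLOCH-CLASS REDUCTION (conjugate-PAIR form after review p4 g13 / D25-5: `VF` is real, so a single-label real datum lives on
  `(ℓ + nℤ³) ∪ (−ℓ + nℤ³)`): the pair projection `P_{±ℓ}` is the real isotypic projection of the finite translation group `(n⁻¹ℤ/ℤ)³` under which the cell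
  problem is invariant — a finite combination of translates, L²-self-adjoint, commuting with `b·∇` and `𝔸∇²` — so `P_{±ℓ}u` solves the cell problem with datum
  `P_{±ℓ}F`, energies add over pairs (orthogonal isotypic components), and the all-class statement gives the flat clause with the SAME `CK, cK, ν₀` (no per-class
  existence/uniqueness needed);
* `stub_compactRange` (L) — COMPACT LABEL RATIO `r = dist/(nν) ∈ [1/Kb, R₁]`, every `R₁ ≥ 1`: continuity of the slot/period maps in the scale-free variables
  `(r, κ, 𝔸/ν)` incl. the `ν → 0` limit on the slow lines + compactness + the LOSSLESS ANALYSIS (`HighLabelDecayProfile.no_slotTerm_null`, PROVED from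
  `IsotropicCubatureWord.slotTerm_sum`): a period-lossless state would have every slot term zero — impossible; no rate is computed (profile: per-period contraction
  `1 − e^{−0.709·M·r²}` to 4 digits for r ≤ 2, kit j316375/j316406);
* `stub_largeR` (XL) — LARGE LABEL RATIO `r ≥ R₁` for ONE `R₁`: ν-uniform relaxation enhancement of the ONE coupled-unshielded slot that exists for every fibre
  direction (`HighLabelDecayProfile.coupledUnshielded_exists` / `_quant`, PROVED; coverage constant γ₀ = min_{q̂} max_s |ê_s·q̂||m̂_s·q̂| = 0.3955, j316375 = tenure
  F-g25-1) — engine Bedrossian–Coti Zelati 2017 Thm 1.1 (arXiv:1510.08098, `ν/|k| ≤ κ₀` ⇔ `r_s ≥ R₁`, rate ν^{1/2}|k|^{1/2}/log²) ported to the Bloch chain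
  (quasi-periodic cross-stream condition, triangle envelope, two polarisation chains with centre links weakened by |m̂·q̂| ≥ γ₀-type factors, the `𝔸`-window);
  alternative engine p4 g13 F-p4g13-1 (three-mode control functional Φ = E + ε Re⟨w₀, b⟩, first link only).
-/

/-- **W7 piece 1 (M) — PER-CLASS (conjugate-pair) REDUCTION** (p5 g9 re-cut text, verbatim up to the namespace of `ClassDecayW`; `ClassDecayW` carries the pair clause of D25-5). -/
theorem stub_classReduction {k : ℕ} (W : LatticeShear.LatticeWord k) (M : ℝ) (hM : 0 < M) (lo hi Λ β ν₀ Kb CK cK : ℝ)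
    (hlo : 0 < lo) :
    ClassDecayW W M hM lo hi Λ β ν₀ Kb CK cK admAll → HighLabelDecayW W M hM lo hi Λ β ν₀ Kb CK cK :=
  -- v8: W7 piece 1 DISCHARGED in-skeleton by w1 g3's landed `classReduction_of_pos` (p668138, commit 46c40754f2d7);
  -- the by-name alias file was refused as `dedup.landed`, so the registry closes it here (open stubs: 4).
  Summit.AnomalousDissipation.AnomalousDissipation.Theorems.SolenoidalFractalHomogenisation.LagrangianStep.classReduction_of_pos
    W M hM lo hi Λ β ν₀ Kb CK cK hlo

/-- **W7 piece 2 (L) — COMPACT LABEL RANGE** `r ∈ [1/Kb, R₁]`, every `R₁ ≥ 1` (p5 g9 re-cut text): continuity + compactness + lossless analysis; no rate computed. -/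
theorem stub_compactRange (M : ℝ) (hM : 0 < M) (lo hi Λ β : ℝ) (hlo : 0 < lo) (hlo1 : lo ≤ 1) (hhi : 1 ≤ hi) (hΛ : 1 < Λ)
    (hβ : 0 ≤ β) (Kb : ℝ) (hKb : 1 ≤ Kb) (R₁ : ℝ) (hR₁ : 1 ≤ R₁) :
    ∃ CK : ℝ, 1 ≤ CK ∧ ∃ cK > (0:ℝ), ∃ ν₀ > (0:ℝ),
      ClassDecayW Summit.AnomalousDissipation.AnomalousDissipation.Theorems.cubatureWord M hM lo hi Λ β ν₀ Kb CK cK (admCompact R₁) :=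
  Summit.AnomalousDissipation.AnomalousDissipation.Theorems.SolenoidalFractalHomogenisation.LagrangianStep.stub_compactRange M hM lo hi Λ β hlo hlo1 hhi hΛ hβ Kb hKb R₁ hR₁  -- v11: W7 piece 2 PROVED BY NAME (p1 g11, p677887)
/-- **W7 piece 3 (XL) — LARGE LABEL RATIO** `r ≥ R₁` for ONE `R₁ ≥ 1` (p5 g9 re-cut text): ν-uniform relaxation enhancement of the coupled-unshielded slot
(Bedrossian–Coti Zelati 2017 Thm 1.1 engine ported to the Bloch chain; or p4 g13's three-mode control functional). -/
theorem stub_largeR (M : ℝ) (hM : 0 < M) (lo hi Λ β : ℝ) (hlo : 0 < lo) (hlo1 : lo ≤ 1) (hhi : 1 ≤ hi) (hΛ : 1 < Λ)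
    (hβ : 0 ≤ β) (Kb : ℝ) (hKb : 1 ≤ Kb) :
    ∃ R₁ : ℝ, 1 ≤ R₁ ∧ ∃ CK : ℝ, 1 ≤ CK ∧ ∃ cK > (0:ℝ), ∃ ν₀ > (0:ℝ),
      ClassDecayW Summit.AnomalousDissipation.AnomalousDissipation.Theorems.cubatureWord M hM lo hi Λ β ν₀ Kb CK cK (admLarge R₁) :=
  Summit.AnomalousDissipation.AnomalousDissipation.Theorems.SolenoidalFractalHomogenisation.LagrangianStep.stub_largeR M hM lo hi Λ β hlo hlo1 hhi hΛ hβ Kb hKb  -- v11: W7 piece 3 PROVED BY NAME (p1 g11, p677887)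
/-- **W7 (the v4 REGISTERED text, unchanged) — PROVED in-skeleton from the three pieces** by p5 g9's composition `highLabelDecay_IS_of_recut` (kernel-checked). -/
theorem stub_highLabelDecay_IS : ∀ (M : ℝ) (hM : 0 < M) (lo hi Λ β : ℝ), 0 < lo → lo ≤ 1 → 1 ≤ hi → 1 < Λ → 0 ≤ β →
    ∀ Kb : ℝ, 1 ≤ Kb → ∃ CK : ℝ, 1 ≤ CK ∧ ∃ cK > (0:ℝ), ∃ ν₀ > (0:ℝ),
      HighLabelDecayW Summit.AnomalousDissipation.AnomalousDissipation.Theorems.cubatureWord M hM lo hi Λ β ν₀ Kb CK cK := by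
  intro M hM lo hi Λ β hlo hlo1 hhi hΛ hβ Kb hKb
  obtain ⟨R₁, hR₁, CK₂, hCK₂, cK₂, hcK₂, ν₂, hν₂, h₂⟩ := stub_largeR M hM lo hi Λ β hlo hlo1 hhi hΛ hβ Kb hKb
  obtain ⟨CK₁, hCK₁, cK₁, hcK₁, ν₁, hν₁, h₁⟩ := stub_compactRange M hM lo hi Λ β hlo hlo1 hhi hΛ hβ Kb hKb R₁ hR₁
  refine ⟨max CK₁ CK₂, le_max_of_le_left hCK₁, min cK₁ cK₂, lt_min hcK₁ hcK₂, min ν₁ ν₂, lt_min hν₁ hν₂, ?_⟩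
  exact stub_classReduction _ _ _ _ _ _ _ _ _ _ _ hlo (classDecayW_split R₁ (zero_le_one.trans hCK₁) h₁ h₂)

-- v2 RE-CUT (D24-2 (c)/D24-4): the `hone` binder of the LANDED `chainLower_of_pieces_ISW` VERBATIM (family Φ read at ν = cellVisc_{m+1}; window facts on S and Φ S as hypotheses;
-- `SlowVectorClauseF`; `CellEnergyClausesW`; no existence conjunct).  Docstring of v1′ `stub_oneLevelL` above applies word for word.
-- v4: IW_H = that text + the high-label decay family (H) as a hypothesis (inserted after the (F) line, same position as in S23‴); DISCHARGED by the inline glue below from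
-- S0′ `stub_windowPropagatorL` and S23‴ `stub_windowDefectH`; consumed AT THE DESIGN WORD by `GlueH.chainLower_of_oneLevel_at` in the composition.

/-- (XL−; v10 — the two-scale heart of v9's `stub_chainL`, LOCAL in the level) ONE-LEVEL COMPARISON.  From the re-cut cell package (`Φ` with
its invariant windows; the slow-vector clause with constants `σ, C, ν₀, K`; the cell-energy clauses with constants `Cf, νf, Kf`): regime pins
`ν₁, K₁`, template constants `Λ₀, θ₀` and an error law `C₁ρ^{σ₁}`, uniform in the carrier, such that for every permissible regular Lagrangian
carrier `E` on the template and every class `R` there is `m⋆` beyond which, for EVERY window shape `S` (`OddSmall β`, `NearIso lo hi`) and every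
class-`R` datum, the level-`m` truncated problem with the RENORMALISED tensor `kbar_m · renormStep Φ (gain/cellVisc_{m+1}²) S` has a weak solution
(tensor Lions/Galerkin along the bounded divergence-free partial sum — the ad-lit tensor road), and every weak solution `u` of the level-`(m+1)`
truncated problem with viscosity tensor `kbar_{m+1}·S` and every weak solution `v` of that level-`m` problem have energy drops on `(1/2, 1)`
within the ratio `1 ± C₁ (N_m/N_{m+1})^{σ₁}` (Armstrong–Vicol Prop. 5.2 / §5.3 in the Lagrangian frames of `b_{≤m}`: the level-`(m+1)` cell
problem IS the package's at `ν = cellVisc_{m+1}`, `n = N_{m+1}`, package time = `a_{m+1} ×` physical time; slow modes `|ℓ| ≤ N_m ρ^{-1/8}` by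
(T3); rate errors `e ≤ C(ρ^{σ/4} + ρ^{σ/8})` by (T2)/(T3), distortion `≤ θ₀ρ^{1/16}` by (T4), refresh transients `≤ ρ^{1/16}` by (T5).  The
comparison must be obtained RELATIVE TO THE DROP at the level of the dissipation integrals `2∫₀ᵗ⟨kbar·S∇u, ∇u⟩` — clause (V) is decay-relative
for exactly this purpose — and NOT as an absolute `L∞L²` bound divided by an a-priori drop: the only a-priori drop is `stub_baseT`'s
`(1 − e^{−4π²kbar_m lo})E₀`, and `kbar_m → 0`; the `E`-dependent slack of clause (C) and the class `R` go into `m⋆`). -/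
theorem stub_oneLevelL_IWH : ∀ k (W : Literature.Analysis.FluidPDE.LatticeShear.LatticeWord k) (M : ℝ) (hM : 0 < M) (c : ℝ), 0 < c →
    ∀ (Φ : ℝ → Torus.Visc4 (Fin 3) → Torus.Visc4 (Fin 3)) (lo hi Λ β σ C ν₀ K Cf νf Kf : ℝ),
      0 < lo → lo ≤ 1 → 1 ≤ hi → 1 < Λ → 0 ≤ β →
      0 < σ → 0 ≤ C → 0 < ν₀ → 0 < K → SlowVectorClauseF W M hM c Φ lo hi Λ β σ C ν₀ K →
      0 ≤ Cf → 0 < νf → 0 < Kf → CellEnergyClausesW W M hM c lo hi Λ β Cf νf Kf →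
      (∀ Kb : ℝ, 1 ≤ Kb → ∃ CK : ℝ, 1 ≤ CK ∧ ∃ cK > (0:ℝ), ∃ νh > (0:ℝ), HighLabelDecayW W M hM lo hi Λ β νh Kb CK cK) →
      ∃ ν₁ > (0:ℝ), ∃ K₁ > (0:ℝ), ∃ Λ₀ : ℕ, ∃ θ₀ > (0:ℝ), ∃ C₁ > (0:ℝ), ∃ σ₁ > (0:ℝ),
        ∀ E : Literature.Analysis.FluidPDE.LatticeShear.LagrangianLatticeCarrier k, E.design = W.stretch M hM → E.gain = c → E.nu0 = ν₁ → E.K = K₁ → E.LPermissible → E.Regular → (∀ m, Λ₀ * E.N m ≤ E.N (m + 1)) → (∀ m, E.N m ^ 2 ≤ E.N (m + 1)) → (∀ m, E.cellVisc (m + 1) * ((E.N (m + 1) : ℝ) / E.N m) ^ (1 / 4 : ℝ) ≤ 1) → (∀ m, E.K * ((E.N (m + 1) : ℝ) / E.N m) ^ (1 / 4 : ℝ) ≤ ((E.N (m + 1) : ℝ) / E.N m) * E.cellVisc (m + 1)) → (∀ m, E.θ (m + 1) * ((E.N (m + 1) : ℝ) / E.N m) ^ (1 / 16 : ℝ) ≤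 θ₀) → (∀ m, ((E.N (m + 1) : ℝ) / E.N m) ^ (1 / 16 : ℝ) * E.physPeriod (m + 1) ≤ E.refresh (m + 1)) →
        ∀ R : ℝ≥0, ∃ mstar : ℕ, ∀ m, mstar ≤ m →
          ∀ S : Torus.Visc4 (Fin 3), Torus.OddSmall S β → Torus.NearIso S lo hi →
            Torus.OddSmall (Φ (E.cellVisc (m + 1)) S) β → Torus.NearIso (Φ (E.cellVisc (m + 1)) S) lo hi →
          ∀ (w₀ : VF), IsDatum w₀ → InClass R w₀ →
          ∀ u v : ℝ → VF, TSol E (m + 1) (E.kbar (m + 1) • S) w₀ u →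
            TSol E m (E.kbar m • renormStep (Φ (E.cellVisc (m + 1))) (E.gain / E.cellVisc (m + 1) ^ 2) S) w₀ v →
            ∀ᵐ t ∂(volume.restrict (Ioo (1/2 : ℝ) 1)),
              (1 - C₁ * ((E.N m : ℝ) / E.N (m + 1)) ^ σ₁) * drop w₀ v t ≤ drop w₀ u t :=
  oneLevelL_IWH_of_piecesH stub_windowPropagatorL stub_windowDefectH

/-- (M; DISCHARGED by name from p609829 exactly as in the registered r22 v10 — statement byte-identical) Telescoping: the chain gives the cascade (`∏ (1 − Cρ_m^σ) ≥ θ > 0` over the super-geometric template, existence threaded downwards). -/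
theorem stub_cascadeT : ∀ k (E : LatticeShear.LagrangianLatticeCarrier k), E.LPermissible → (∀ m, E.N m ^ 2 ≤ E.N (m + 1)) →
    ChainLower E → Cascade E := by
  intro k E hP hsq hCh
  exact cascade_of_chainLower E hP hsq hCh



/-! ## Composition -/

/- Composition (kernel-checked, no sorry outside the stubs): the seven stubs, consumed BY NAME, give the crux — v9's composition with
`Chain E` supplied by `chain_of_pieces stub_baseT stub_oneLevelL` from the re-cut cell package (`stub_cellLawV` + `stub_cellEnergyT`);
v4: `ChainLower E` from `GlueH.chainLower_of_oneLevel_at stub_baseT … (stub_oneLevelL_IWH 26 cubatureWord … (stub_highLabelDecay_IS …))`.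
This is the ONLY theorem of the file whose conclusion is the crux decl (skeleton audit rule: the crux-headed theorem may carry no `Prop`
hypotheses other than registered obligations, so there is no separate hypothesis-form `_of_stubs`). -/
-- (docstring above belongs to `LagrangianRenormalisationStepCubature_of` below)
theorem LagrangianRenormalisationStepDesign_of :
    Summit.AnomalousDissipation.AnomalousDissipation.Theses.SolenoidalFractalHomogenisation.LagrangianRenormalisationStepDesign := by
  intro _hK2R
  have hlaw := stub_gainPackageW0
  obtain ⟨M, hM, c, hc', Φ, μ, Sstar, slo, shi, lam₀, Λ, Λc, Λ', τlo, τhi, τc, lo, hlo, hi, hlo1, hhi1, ΛV, hΛV, β, hβ, hWF, σ, hσ, C, hC, ν₀, hν₀, K, hK, hV'⟩ :=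
    stub_cellLawV0_IS hlaw
  have hV := slowVectorClauseF_of_noExF_familyS hc' hlo (zero_le_one.trans hhi1) hK hβ hWF hV'
  obtain ⟨Cf, hCf, νf, hνf, Kf, hKf, hEW⟩ := stub_cellEnergyT 26 Summit.AnomalousDissipation.AnomalousDissipation.Theorems.cubatureWord M hM c hc' lo hi ΛV β hlo hlo1 hhi1 hΛV hβ
  have hEcl := cellEnergyClausesW_of_noE hlo hKf hEW
  -- v4: the high-label decay family (H) for the design (W7), threaded into the one-level comparison IW_H, glued AT the design word
  have hH := stub_highLabelDecay_IS M hM lo hi ΛV β hlo hlo1 hhi1 hΛV hβ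
  obtain ⟨ν₁, hν₁, K₁, hK₁, Λ₀, θ₀, hθ₀, hchain⟩ :=
    chainLower_of_oneLevel_at stub_baseT hlo hhi1 hWF
      (stub_oneLevelL_IWH 26 Summit.AnomalousDissipation.AnomalousDissipation.Theorems.cubatureWord M hM c hc' Φ lo hi ΛV β σ C ν₀ K Cf νf Kf
        hlo hlo1 hhi1 hΛV hβ hσ hC hν₀ hK hV hCf hνf hKf hEcl hH)
  obtain ⟨Λ₁, θs, hθs, htail⟩ := stub_tailL 26 (Summit.AnomalousDissipation.AnomalousDissipation.Theorems.cubatureWord.stretch M hM)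
  refine ⟨26, Summit.AnomalousDissipation.AnomalousDissipation.Theorems.cubatureWord.stretch M hM, c, hc', ν₁, hν₁, K₁, hK₁, max Λ₀ Λ₁, min θ₀ θs, lt_min hθ₀ hθs, ?_⟩
  intro E hW hg hn hK' hP hR hsep hsq h2 h3 h4m h5
  -- v17: (T4) at `min θ₀ θs` gives the chain's clause at `θ₀` and the tail stub's at `θs` (monotone in the budget)
  have h4 : ∀ m, E.θ (m + 1) * ((E.N (m + 1) : ℝ) / E.N m) ^ (1 / 16 : ℝ) ≤ θ₀ := fun m => (h4m m).trans (min_le_left _ _)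
  have hsep0 : ∀ m, Λ₀ * E.N m ≤ E.N (m + 1) := fun m =>
    le_trans (Nat.mul_le_mul_right _ (le_max_left Λ₀ Λ₁)) (hsep m)
  have hsep1 : ∀ m, Λ₁ * E.N m ≤ E.N (m + 1) := fun m =>
    le_trans (Nat.mul_le_mul_right _ (le_max_right Λ₀ Λ₁)) (hsep m)
  have hCh : ChainLower E := hchain E hW hg hn hK' hP hR hsep0 hsq h2 h3 h4 h5
  obtain ⟨a, ha, hcas⟩ := stub_cascadeT 26 E hP hsq hCh
  intro R
  obtain ⟨mstar, θ, hθ, j₁, hj₁⟩ := hcas R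
  have hlo' : 0 < E.kbar mstar * a := mul_pos (E.kbar_pos mstar) ha
  set cb : ℝ := 1 - Real.exp (-(4 * Real.pi ^ 2 * (E.kbar mstar * a))) with hcb_def
  have hcb : 0 < cb := by
    have hexp : Real.exp (-(4 * Real.pi ^ 2 * (E.kbar mstar * a))) < 1 := by
      rw [Real.exp_lt_one_iff]
      have : 0 < 4 * Real.pi ^ 2 * (E.kbar mstar * a) := by positivity
      linarith
    rw [hcb_def]; linarith
  obtain ⟨j₂, hj₂⟩ := htail E hW hP hR hsep1 hsq h2 (min θ₀ θs) (min_le_right _ _) h4m (θ * cb / 2) (by positivity)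
  refine ⟨θ * cb / 2, by positivity, max j₁ j₂, ?_⟩
  intro j hj w₀ hH1 hmean hdiv hclass w hw
  have hdat : IsDatum w₀ := ⟨hH1, hmean, hdiv⟩
  have hcl : InClass R w₀ := hclass
  obtain ⟨u, hu⟩ := stub_existsL 26 E hP hR j w₀ hdat
  obtain ⟨𝔸s, hi', hNI, hrest⟩ := hj₁ j (le_trans (le_max_left _ _) hj)
  obtain ⟨v, hv, hratio⟩ := hrest w₀ u hdat hcl hu
  have hbase := stub_baseT 26 E hP hR mstar 𝔸s (E.kbar mstar * a) hi' hlo' hNI w₀ v hdat hv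
  have htl := hj₂ j (le_trans (le_max_right _ _) hj) w₀ w u hdat hw hu
  filter_upwards [hbase, hratio, htl] with t hb hr ht
  have h1 : θ * (cb * Torus.vectorL2Sq w₀) ≤ θ * drop w₀ v t := mul_le_mul_of_nonneg_left hb hθ.le
  have e : Torus.vectorL2Sq w₀ = ∫ x, ‖w₀ x‖ ^ 2 := rfl
  unfold drop at h1 hr ht
  rw [← e]
  nlinarith [h1, hr, ht, hθ, hcb]

end

end Summit.AnomalousDissipation.AnomalousDissipation.Cruxes.LagrangianRenormalisationStepDesign.OneLevel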